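import Mathlib
import Summits.ValiantsHypothesis.ValiantsHypothesis.Theorems.NewtonUnitEquationsTwoProductsFormalLogLinearisationDefs
import Summits.ValiantsHypothesis.ValiantsHypothesis.Theorems.TwoProducts.Negative.RowCoincidenceThreeDigitBox
import HarnessLib

/-!
# Crux `TwoProducts` (stmt-ValiantsHypothesis-5906) — FIRST VARIATION at the identity locus (val-idea-34 g11, lens (c) «rank-one datum»)

val-idea-34 g11 (planner · ideation; no claim; kit 0; VP ≠ VNP is NOT proved; `TwoProducts`, `ResidualLawV25`,
`PlanarCellBound`, `DigitGridLLLaw` stay OPEN).  Companion of `Cruxes/TwoProducts/LetterForcing_val_idea_34_g11.lean`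
(rev 2 @8eef9c8bb12a) and of the crux idea card `first-variation-resolvent` (this session).

THE MOVE.  Restrict the two-products difference to pairs whose DIFFERENCE DATUM HAS RANK ONE,
`v_j = u_j + τ_j·X^t` (one letter `t`, weights `τ ∈ ℂ^m`).  Then
`∏(1+v_j) − ∏(1+u_j) = X^t·G_τ + X^{2t}·G₂ + … + X^{mt}·τ₁⋯τ_m`, with the FIRST VARIATION
`G_τ = Σ_j τ_j ∏_{i≠j}(1+u_i) = (∏_i (1+u_i)) · Σ_j τ_j/(1+u_j)` — one family of rows and the RESOLVENT SUM
`R_τ = Σ_j τ_j (1+u_j)^{-1}` instead of two products.  Every statement of the sub-box cascade (card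
`subbox-congruence-cascade`) has a first-variation twin: L1 (box congruence) ↦ `G_τ(u^B) ≡ 0 mod box`; multiset
coincidence ↦ "`Σ_{u_j^B = w} τ_j = 0` for every truncated row value `w`"; UFD (carry-free rigidity) ↦ partial fractions /
Vandermonde; the count ↦ `#vert Γ₊(R_τ)`.  The E_T pencil family of the Negative lane
(`…Negative.RowCoincidence.threeDigitBox_witness`, ✓ p690924; RIGID-BOX j322825: 34/34 exact non-coincident records have
difference datum of rank one — checked from `misses.jsonl` this session) IS the first variation along the top digit column.

THIS FILE (rev 6 = rev 3 + §6; 0 sorry; defs `boxTrunc` / `DigitGrid` / `llVisible` are the landed VERBATIM copies of the workfile's, imported from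
`Theorems/TwoProducts/Negative/RowCoincidenceThreeDigitBox.lean`, so every statement below is in the SAME currency as (U1′) and as
`not_rowCoincidence_on_digitGrid`):

§1 VANDERMONDE-DEFECT WITNESS (`s = 3`, `m = 3`, base 2, integer coefficients; exact).  Rows
`1 + u = (1 + 2X^a, 1 − 2X^a, 1 − 4X^e)`, `1 + v = (1 + 2X^a + X^t, 1 − 2X^a + X^t, 1 − 4X^e − 2X^t)` with the DIAGONAL letters
`a = (1,1)`, `e = (2,2) = 2a`, `t = (4,4) = 2e`: the carry `(1+2X^a)(1−2X^a) = 1 − 4X^e` makes `Σ_j τ_j/(1+u_j) = 0` for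
`τ = (1,1,−2)` although no two rows are proportional (the partial-fraction / Vandermonde uniqueness of the carry-free world
fails in base 2), hence `G_τ = 0` EXACTLY and `∏(1+u) − ∏(1+v) = 3X^{(8,8)} + 4X^{(10,10)} + 2X^{(12,12)}` (`tailDiff_eq`).
So `p = (2³,2³)` is LL-visible (`pp_mem_llVisible`), its identity box `[0,2³)²` contains EVERY letter of every row, the truncated
rows are the rows themselves, they are NOT equal as multisets (`truncated_rows_ne`; not projectively either), and the truncated
table `{u_j^B} ∪ {v_j^B}` has AFFINE RANK 3 (`not_affRankLeTwo`: the differences `−4X^a`, `−2X^a − 4X^e`, `X^t` are linearly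
independent).  By the RB5 classifier of RIGID-BOX the record is «type T» (deleting the column `x = 2² ` removes `t`, after which
`u = v`), consistent with the census' «0 OTHER»; but it is NOT of affine rank `≤ 2`.

§2 CONSEQUENCE (`not_coincidence_or_affRankLeTwo`).  The RIGIDITY-OR-RANK-TWO dichotomy D2 proposed on the bus
(val-idea-crit-8 g3, val-lit STATUS 2026-08-29T02:52:24Z: «∀ γ1 instance, ∀ LL-visible p of class ≥ (3,3): rows on B(p)
coincide as a projective multiset OR the B(p)-truncated table has affine rank ≤ 2») is FALSE at `m = 3` as worded — typed here with
the quantifier shape of `not_rowCoincidence_on_digitGrid` and the weakest reading of «affine rank ≤ 2» (all `2m` truncated rows in one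
affine 2-plane `w₀ + span{w₁,w₂}`; the projective/linear reading implies it).  The pencil branch of the cascade is therefore NOT inside
the rank-≤-2 world decided by val-idea-35 g9's Jacobian theorem (VERDICT #28) once `m ≥ 3`: the radix chain
`(1+w)(1−w)(1+w²)⋯ = 1 − w^{2^k}` gives first-variation solutions of L1 whose tables have affine rank `m` for every `m`
(`m = 4`: rows `(2X^a, −2X^a, 4X^e, −16X^t)`, `τ = (1,1,2,−4)`, deformation letter `(8,8)`, `p = (16,16)`, affine rank 4 —
exact arithmetic in the seat folder `g11/fv_witness.py`, not in this file).

§3 TYPED OPEN TARGETS of the first-variation line (statements only, nothing asserted): `llVisibleOf`, `firstVariation`,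
`LinearisedLLLaw` / `LinearisedLLLawLinear` («`#LL-vertices of Γ₊(Σ_j τ_j ∏_{i≠j}(1+u_i)) ≤ C·m^c·s²` (resp. `·s`) for digit-grid
rows»), and `FirstVariationTransfer` (the digit-gap argument `DigitGridLLLaw ⇒ LinearisedLLLaw`, paper-proved in the note
`FirstVariation_val_idea_34_g11.md` §3; Lean size M).  The linearised law is a NECESSARY condition for the laws of record and has
content from `m = 4` on (linear currency) / `m = 6` on (`s²` currency) by the CEILING geometry of `T(s,m−1,2)`.

§4 (REV 2) FIRST RUNG OF THE CANCELLATION LADDER — KERNEL (`firstRung`, `firstRung_of_forall`, abstract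
`llVisibleOf_subset_letters_or_doubles` + `ncard_llVisibleOf_le_succ`; LIN-T v1 read-out `LINT_val_idea_34_g11.md` §4(b), accepted on
paper by val-idea-crit-8 g3 03:45:15Z, asked as (α)): rows on `A_s`, `Σ τ = 0`; if for every LL direction `ξ` some `ξ`-maximal letter
`v` of `W = ⋃ supp u_j` has `coeff (2v) (firstVariation u τ) ≠ 0` (in particular if NO doubled letter cancels), then
`#llVisibleOf (firstVariation u τ) ≤ s + 1` — every LL-visible point is a letter or a doubled letter (`2Γ₊(W) ⊆ Γ₊(G_τ)`), and these
have ≤ s+1 distinct `x`-coordinates.  Valid for every `m`; so every count above `s + 1` (all LIN-T maximisers: 7/9/9 at s = 5/6/7)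
REQUIRES an order-2 cancellation at a direction-maximal letter.  Axioms of the §4 theorems: propext · Classical.choice · Quot.sound
(`#guard_msgs` on `#print axioms`, seat scratch `AxCheckFV2.lean`).  `LinearisedLLLawLinear` itself stays OPEN.

§5 (REV 3) LADDER CONTAINMENT AT LEVEL k — KERNEL (`ladderContainment`, `ladderContainment_firstVariation`; answers «what can
one more order of cancellation free?», val-idea-crit-8 g3 03:45:15Z (β) / 03:50:36Z): if at every LL direction some maximal letter
`d` has a live pure multiple `i•d`, `1 ≤ i ≤ k+1`, then every LL-visible point of `firstVariation u τ` is a sum of ≤ k letters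
(`lowSums W k`) or such a pure multiple — any `m`, any supports.  k = 1 is §4; at k = 2 the visible set sits inside the 2-bit set
`LevelTwoSet s`, whose LL-chain ceiling is `4s − 5` by exact data (s ≤ 11; typed as `TwoBitChainCeiling` — PROVED in §6, rev 4, C = 8); so a count
above the level-2 ceiling needs order-3 pure-power nulls at all maximal letters of some direction (at m = 4: finitely many column
directions by Bézout, among them the all-order-null paired columns `(p,q,p,q)` when `τ_j = −τ_{j'}`).

§6 (REV 4, val-idea-34 g12) THE 2-BIT CHAIN CEILING — KERNEL (`twoBitChainCeiling_holds : TwoBitChainCeiling`, C = 8: every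
polynomial supported on `LevelTwoSet s` has ≤ 8(s+1) LL-visible points; exact data 4s − 5).  Proof = BLOCKS + LOG-SLOPE POTENTIAL:
the visible set is an antichain with strictly decreasing edge slopes (`TwoBit.convex3/convex4`); the binary block label
`T = ⌊log₂ x⌋ + (s+2 − ⌊log₂ y⌋)` is monotone along it and injective on block-first points (≤ 2s+2); in-block residues are 0 or ONE
power of two, whence the GAP LEMMA `r'/2 ≤ x' − x ≤ r'` for same-level 2-bit numbers (`TwoBit.gap`), which turns the slope
comparison of two edges into `n(q') ≥ n(q) − 1` for the proxy `n = log₂ rx(q) − log₂ ry(pred q)` (+2 inside a block), so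
`Φ = n + 2T` is injective on the other points (≤ 6s+6).  Why level 3 is quadratic (g10 N4): its in-block residues have unit gaps.
SECOND RUNG (rev 5, `secondRung` = §5 at k = 2 + the ceiling): rows on `A_s`, every LL direction has a maximal letter `d` with a live
pure multiple `i•d`, `i ≤ 3` ⇒ `#llVisibleOf (firstVariation u τ) ≤ 8(s+1) + 3` (the level-2 ladder set lies in `LevelTwoSet s` but for
the origin and unit-coordinate letters, ≤ 3 visible; `levelTwo_or_small`); so a count above `8s + 11` needs order-3 pure-power nulls at
EVERY maximal letter of some LL direction.  First rung `firstRung` (order 2 live ⇒ ≤ s+1) is rev 2.  Rev 6: the two hypotheses as NAMED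
binders `OnDigitGrid s u`, `LiveOrderThree u τ` and `secondRung_named : OnDigitGrid s u → LiveOrderThree u τ → #llVisibleOf ≤ 8(s+1)+3` (crit-8 #48).
Axioms of `twoBitChainCeiling_holds` / `secondRung`: propext · Classical.choice · Quot.sound (farm `lean check --axioms`, seat g12).

HONEST FRAME: a negative lemma on a proposed junction statement, typed open targets, the first rung of a count, and (rev 4–6) the
level-2 geometric ceiling with the second rung; `LinearisedLLLawLinear` is NOT implied; `TwoProducts`, `ResidualLawV25`, `PlanarCellBound`, `DigitGridLLLaw(Linear)`, (U1″) and `VP ≠ VNP` are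
UNTOUCHED / NOT proved. [folklore]
-/

noncomputable section

set_option linter.dupNamespace false

open scoped BigOperators
open MvPolynomial
open Summit.ValiantsHypothesis.ValiantsHypothesis.Theorems.NewtonUnitEquations.TwoProducts.FormalLogLinearisation
open Summit.ValiantsHypothesis.ValiantsHypothesis.Theorems.NewtonUnitEquations.TwoProducts.Negative.RowCoincidence
  (boxTrunc DigitGrid llVisible coeff_boxTrunc C_mul_X_eq xi xi_zero xi_one wt_xi)

namespace Summit.ValiantsHypothesis.ValiantsHypothesis.Cruxes.TwoProducts.FirstVariation

/-! ## §1  The Vandermonde-defect witness (`s = 3`, `m = 3`) -/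

/-- the letter `a = (2⁰,2⁰) = (1,1)`. -/
def la : Expo := Finsupp.single 0 1 + Finsupp.single 1 1
/-- the letter `e = (2¹,2¹) = (2,2) = 2a` (the carry `a + a`). -/
def le : Expo := Finsupp.single 0 2 + Finsupp.single 1 2
/-- the deformation letter `t = (2²,2²) = (4,4)`. -/
def lt : Expo := Finsupp.single 0 4 + Finsupp.single 1 4
/-- the LL-visible point `p = 2t = (8,8)`. -/
def pp : Expo := lt + lt

@[simp] theorem la_zero : la 0 = 1 := by simp [la]
@[simp] theorem la_one : la 1 = 1 := by simp [la]
@[simp] theorem le_zero : le 0 = 2 := by simp [le]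
@[simp] theorem le_one : le 1 = 2 := by simp [le]
@[simp] theorem lt_zero : lt 0 = 4 := by simp [lt]
@[simp] theorem lt_one : lt 1 = 4 := by simp [lt]
@[simp] theorem pp_zero : pp 0 = 8 := by simp [pp]
@[simp] theorem pp_one : pp 1 = 8 := by simp [pp]

theorem la_ne_le : la ≠ le := fun h => by have := congrArg (· 0) h; simp at this
theorem la_ne_lt : la ≠ lt := fun h => by have := congrArg (· 0) h; simp at this
theorem le_ne_lt : le ≠ lt := fun h => by have := congrArg (· 0) h; simp at this
theorem pp_ne_pple : pp ≠ pp + le := fun h => by have := congrArg (· 0) h; simp at this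
theorem pp_ne_pplt : pp ≠ pp + lt := fun h => by have := congrArg (· 0) h; simp at this
theorem pple_ne_pplt : pp + le ≠ pp + lt := fun h => by have := congrArg (· 0) h; simp at this

/-- a three-letter row `x·X^a + y·X^e + z·X^t` (all witness rows have this shape). -/
def row (x y z : ℂ) : MvPolynomial (Fin 2) ℂ := monomial la x + monomial le y + monomial lt z

/-- Coefficients of a row. -/
theorem coeff_row (x y z : ℂ) (q : Expo) :
    coeff q (row x y z) = (if la = q then x else 0) + (if le = q then y else 0) + (if lt = q then z else 0) := by
  simp [row, coeff_monomial]

@[simp] theorem coeff_row_la (x y z : ℂ) : coeff la (row x y z) = x := by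
  rw [coeff_row, if_pos rfl, if_neg (Ne.symm la_ne_le), if_neg (Ne.symm la_ne_lt)]; ring
@[simp] theorem coeff_row_le (x y z : ℂ) : coeff le (row x y z) = y := by
  rw [coeff_row, if_neg la_ne_le, if_pos rfl, if_neg (Ne.symm le_ne_lt)]; ring
@[simp] theorem coeff_row_lt (x y z : ℂ) : coeff lt (row x y z) = z := by
  rw [coeff_row, if_neg la_ne_lt, if_neg le_ne_lt, if_pos rfl]; ring

/-- Rows subtract letter-wise. -/
theorem row_sub (x y z x' y' z' : ℂ) : row x y z - row x' y' z' = row (x - x') (y - y') (z - z') := by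
  simp only [row, map_sub]; ring

/-- tails `u = (2X^a, −2X^a, −4X^e)`: the factors `1 + u_j` satisfy the CARRY RELATION `(1+2X^a)(1−2X^a) = 1 − 4X^e`. -/
def uu : Fin 3 → MvPolynomial (Fin 2) ℂ := ![row 2 0 0, row (-2) 0 0, row 0 (-4) 0]
/-- tails `v = u + τ·X^t`, `τ = (1, 1, −2)` (difference datum of rank one). -/
def vv : Fin 3 → MvPolynomial (Fin 2) ℂ := ![row 2 0 1, row (-2) 0 1, row 0 (-4) (-2)]

/-- A row in `C · X₀^i X₁^k` form (for `ring`). -/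
theorem row_eq (x y z : ℂ) :
    row x y z = C x * X 0 ^ 1 * X 1 ^ 1 + C y * X 0 ^ 2 * X 1 ^ 2 + C z * X 0 ^ 4 * X 1 ^ 4 := by
  rw [C_mul_X_eq, C_mul_X_eq, C_mul_X_eq]; rfl

/-- THE FIRST-VARIATION IDENTITY of the witness: `∏(1+u) − ∏(1+v) = 3X^{(8,8)} + 4X^{(10,10)} + 2X^{(12,12)}` — the `X^t`-strip
`X^t·G_τ` is ABSENT (`G_τ = Σ_j τ_j ∏_{i≠j}(1+u_i) = 0` exactly, by the carry relation), only the `X^{2t}`, `X^{3t}` strips survive. -/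
theorem tailDiff_eq :
    tailDiff uu vv = monomial pp 3 + monomial (pp + le) 4 + monomial (pp + lt) 2 := by
  have h1 : tailDiff uu vv = (1 + row 2 0 0) * (1 + row (-2) 0 0) * (1 + row 0 (-4) 0)
      - (1 + row 2 0 1) * (1 + row (-2) 0 1) * (1 + row 0 (-4) (-2)) := by
    simp [tailDiff, uu, vv, Fin.prod_univ_three, mul_assoc]
  have h2 : (1 + row 2 0 0) * (1 + row (-2) 0 0) * (1 + row 0 (-4) 0)
      - (1 + row 2 0 1) * (1 + row (-2) 0 1) * (1 + row 0 (-4) (-2))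
      = (C 3 * X 0 ^ 8 * X 1 ^ 8 + C 4 * X 0 ^ 10 * X 1 ^ 10 + C 2 * X 0 ^ 12 * X 1 ^ 12 : MvPolynomial (Fin 2) ℂ) := by
    simp only [row_eq, map_neg, map_zero, map_one, map_ofNat]
    ring
  have e1 : (Finsupp.single 0 8 + Finsupp.single 1 8 : Expo) = pp := by
    ext i; fin_cases i <;> simp
  have e2 : (Finsupp.single 0 10 + Finsupp.single 1 10 : Expo) = pp + le := by
    ext i; fin_cases i <;> simp
  have e3 : (Finsupp.single 0 12 + Finsupp.single 1 12 : Expo) = pp + lt := by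
    ext i; fin_cases i <;> simp
  rw [h1, h2, C_mul_X_eq, C_mul_X_eq, C_mul_X_eq, e1, e2, e3]

/-- Coefficients of the tail difference. -/
theorem coeff_tailDiff (q : Expo) :
    coeff q (tailDiff uu vv) = (if pp = q then (3 : ℂ) else 0) + (if pp + le = q then (4 : ℂ) else 0)
      + (if pp + lt = q then (2 : ℂ) else 0) := by
  rw [tailDiff_eq, coeff_add, coeff_add, coeff_monomial, coeff_monomial, coeff_monomial]

/-- The support of the tail difference is `{2t, 2t+e, 3t} = {(8,8), (10,10), (12,12)}`. -/
theorem mem_support_tailDiff {q : Expo} (hq : q ∈ (tailDiff uu vv).support) :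
    q = pp ∨ q = pp + le ∨ q = pp + lt := by
  rw [mem_support_iff, coeff_tailDiff] at hq
  by_contra h
  push Not at h
  apply hq
  simp [Ne.symm h.1, Ne.symm h.2.1, Ne.symm h.2.2]

/-- `p = (8,8)` carries the coefficient `3 ≠ 0`. -/
theorem pp_mem_support : pp ∈ (tailDiff uu vv).support := by
  rw [mem_support_iff, coeff_tailDiff, if_pos rfl, if_neg (Ne.symm pp_ne_pple), if_neg (Ne.symm pp_ne_pplt)]
  norm_num

/-- The support of a row is inside `{a, e, t}`. -/
theorem mem_support_row {x y z : ℂ} {q : Expo} (hq : q ∈ (row x y z).support) : q = la ∨ q = le ∨ q = lt := by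
  rw [mem_support_iff, coeff_row] at hq
  by_contra h
  push Not at h
  apply hq
  simp [Ne.symm h.1, Ne.symm h.2.1, Ne.symm h.2.2]

/-- Row letters have negative `ξ`-weight for `ξ = (−1,−1)`. -/
theorem wt_row_neg {x y z : ℂ} {q : Expo} (hq : q ∈ (row x y z).support) : wt xi q < 0 := by
  rcases mem_support_row hq with rfl | rfl | rfl <;> (rw [wt_xi]; norm_num)

/-- `ξ = (−1,−1)` is a valid weight for the witness. -/
theorem validWeight_xi : ValidWeight uu vv xi := by
  refine ⟨fun j q hq => ?_, fun j q hq => ?_⟩ <;> fin_cases j <;> exact wt_row_neg (by simpa [uu, vv] using hq)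

/-- `p = 2t` is the strict `ξ`-top of the tail support (`−16 > −20 > −24`). -/
theorem isStrictTop_pp : IsStrictTop xi (↑(tailDiff uu vv).support : Set Expo) pp := by
  refine ⟨by exact_mod_cast pp_mem_support, fun μ hμ hne => ?_⟩
  rcases mem_support_tailDiff (by exact_mod_cast hμ) with rfl | rfl | rfl
  · exact absurd rfl hne
  · rw [wt_xi, wt_xi]; simp; norm_num
  · rw [wt_xi, wt_xi]; simp; norm_num

/-- `p = (8,8)` is LL-visible; its dyadic class is `(3,3)`. -/
theorem pp_mem_llVisible : pp ∈ llVisible uu vv :=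
  ⟨xi, by simp, by simp, validWeight_xi, isStrictTop_pp⟩

/-- Truncation to the 3-digit box `[0,8)²` does NOTHING to a witness row (all its letters lie inside the box). -/
theorem boxTrunc_row (x y z : ℂ) : boxTrunc 8 8 (row x y z) = row x y z := by
  ext q
  rw [coeff_boxTrunc]
  by_cases h : q 0 < 8 ∧ q 1 < 8
  · simp [h]
  · rw [if_neg h]
    symm
    by_contra hne
    rcases mem_support_row (mem_support_iff.2 hne) with rfl | rfl | rfl <;> simp at h

/-- Truncated `u`-rows = the `u`-rows. -/
theorem boxTrunc_uu (j : Fin 3) : boxTrunc 8 8 (uu j) = uu j := by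
  fin_cases j <;> simp [uu, boxTrunc_row]

/-- Truncated `v`-rows = the `v`-rows. -/
theorem boxTrunc_vv (j : Fin 3) : boxTrunc 8 8 (vv j) = vv j := by
  fin_cases j <;> simp [vv, boxTrunc_row]

/-- No `u`-row involves the letter `t`. -/
theorem coeff_lt_uu (j : Fin 3) : coeff lt (uu j) = 0 := by
  fin_cases j <;> simp [uu]

/-- The truncated rows of the two sides are NOT equal as multisets: `v₂ = −4X^e − 2X^t` has a `t`-letter, no `u_j` does
(so they are not equal up to row-wise scalars either). -/
theorem truncated_rows_ne :
    (Finset.univ.val.map fun j => boxTrunc 8 8 (uu j)) ≠ (Finset.univ.val.map fun j => boxTrunc 8 8 (vv j)) := by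
  intro h
  have hmem : boxTrunc 8 8 (vv 2) ∈ (Finset.univ.val.map fun j => boxTrunc 8 8 (uu j)) := by
    rw [h]; exact Multiset.mem_map.2 ⟨2, Finset.mem_univ_val 2, rfl⟩
  obtain ⟨j, -, hj⟩ := Multiset.mem_map.1 hmem
  rw [boxTrunc_uu, boxTrunc_vv] at hj
  have hc := congrArg (coeff lt) hj
  rw [coeff_lt_uu] at hc
  simp [vv] at hc

/-- «The truncated table has AFFINE RANK ≤ 2» in its weakest reading: all `2m` truncated rows lie in ONE affine 2-plane
`w₀ + span{w₁, w₂}` (the projective / linear-rank-2 reading of RIGID-BOX implies this one). -/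
def AffRankLeTwo {m : ℕ} (N M : ℕ) (u v : Fin m → MvPolynomial (Fin 2) ℂ) : Prop :=
  ∃ w₀ w₁ w₂ : MvPolynomial (Fin 2) ℂ, ∀ j,
    boxTrunc N M (u j) - w₀ ∈ Submodule.span ℂ ({w₁, w₂} : Set (MvPolynomial (Fin 2) ℂ)) ∧
    boxTrunc N M (v j) - w₀ ∈ Submodule.span ℂ ({w₁, w₂} : Set (MvPolynomial (Fin 2) ℂ))

/-- the three difference vectors of the witness table: `u₁ − u₀ = −4X^a`, `u₂ − u₀ = −2X^a − 4X^e`, `v₀ − u₀ = X^t`. -/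
def dvec : Fin 3 → MvPolynomial (Fin 2) ℂ := ![row (-4) 0 0, row (-2) (-4) 0, row 0 0 1]

/-- The three difference vectors are linearly independent (read off the coefficients at `t`, `e`, `a`). -/
theorem linearIndependent_dvec : LinearIndependent ℂ dvec := by
  rw [Fintype.linearIndependent_iff]
  intro g hg
  have ht := congrArg (coeff lt) hg
  have he := congrArg (coeff le) hg
  have ha := congrArg (coeff la) hg
  simp only [Fin.sum_univ_three, dvec, Matrix.cons_val_zero, Matrix.cons_val_one, Matrix.cons_val_two,
    Matrix.head_cons, Matrix.tail_cons, coeff_add, coeff_smul, coeff_zero, coeff_row_la, coeff_row_le, coeff_row_lt,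
    smul_eq_mul, mul_zero, add_zero, zero_add, mul_one] at ht he ha
  -- ht : g 2 = 0,  he : g 1 * (-4) = 0,  ha : g 0 * (-4) + g 1 * (-2) = 0
  have g2 : g 2 = 0 := by linear_combination ht
  have g1 : g 1 = 0 := by linear_combination he / (-4)
  have g0 : g 0 = 0 := by linear_combination ha / (-4) - g1 / 2
  intro i; fin_cases i
  · exact g0
  · exact g1
  · exact g2

/-- The witness table does NOT have affine rank ≤ 2. -/
theorem not_affRankLeTwo : ¬ AffRankLeTwo 8 8 uu vv := by
  rintro ⟨w₀, w₁, w₂, h⟩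
  set S : Submodule ℂ (MvPolynomial (Fin 2) ℂ) := Submodule.span ℂ ({w₁, w₂} : Set (MvPolynomial (Fin 2) ℂ)) with hS
  -- the three differences lie in `S`
  have hd : ∀ i, dvec i ∈ S := by
    have h0 := (h 0).1; have h1 := (h 1).1; have h2 := (h 2).1; have h0' := (h 0).2
    rw [boxTrunc_uu] at h0 h1 h2; rw [boxTrunc_vv] at h0'
    have d1 : uu 1 - uu 0 ∈ S := by
      have := S.sub_mem h1 h0; simpa using this
    have d2 : uu 2 - uu 0 ∈ S := by
      have := S.sub_mem h2 h0; simpa using this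
    have d3 : vv 0 - uu 0 ∈ S := by
      have := S.sub_mem h0' h0; simpa using this
    have e1 : uu 1 - uu 0 = dvec 0 := by
      simp only [uu, dvec, Matrix.cons_val_zero, Matrix.cons_val_one, row_sub]; norm_num
    have e2 : uu 2 - uu 0 = dvec 1 := by
      simp only [uu, dvec, Matrix.cons_val_zero, Matrix.cons_val_one, Matrix.cons_val_two, Matrix.head_cons,
        Matrix.tail_cons, row_sub]; norm_num
    have e3 : vv 0 - uu 0 = dvec 2 := by
      simp only [uu, vv, dvec, Matrix.cons_val_zero, Matrix.cons_val_two, Matrix.head_cons, Matrix.tail_cons,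
        row_sub]; norm_num
    intro i; fin_cases i
    · exact e1 ▸ d1
    · exact e2 ▸ d2
    · exact e3 ▸ d3
  -- `S` is spanned by two vectors, so `finrank S ≤ 2`
  have hfin : Module.finrank ℂ S ≤ 2 := by
    have h2 := finrank_span_finset_le_card (R := ℂ) ({w₁, w₂} : Finset (MvPolynomial (Fin 2) ℂ))
    rw [Finset.coe_pair] at h2
    exact h2.trans Finset.card_le_two
  -- but the three differences are independent inside `S`
  let f : Fin 3 → S := fun i => ⟨dvec i, hd i⟩
  have hf : LinearIndependent ℂ f := by
    apply LinearIndependent.of_comp S.subtype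
    exact linearIndependent_dvec
  haveI : Module.Finite ℂ S := Module.Finite.span_of_finite ℂ (Set.toFinite _)
  have h3 : 3 ≤ Module.finrank ℂ S := by
    simpa using hf.fintype_card_le_finrank
  omega

/-- `a, e, t ∈ A_3` (digit grid with `s = 3`). -/
theorem la_mem_digitGrid : la ∈ DigitGrid 3 := ⟨0, 0, by norm_num, by norm_num, by simp, by simp⟩
theorem le_mem_digitGrid : le ∈ DigitGrid 3 := ⟨1, 1, by norm_num, by norm_num, by simp, by simp⟩
theorem lt_mem_digitGrid : lt ∈ DigitGrid 3 := ⟨2, 2, by norm_num, by norm_num, by simp, by simp⟩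

/-- Rows are supported on the digit grid `A_3`. -/
theorem row_support_digitGrid {x y z : ℂ} : ∀ q ∈ (row x y z).support, q ∈ DigitGrid 3 := fun q hq => by
  rcases mem_support_row hq with rfl | rfl | rfl
  exacts [la_mem_digitGrid, le_mem_digitGrid, lt_mem_digitGrid]

theorem uu_digitGrid : ∀ j, ∀ q ∈ (uu j).support, q ∈ DigitGrid 3 := by
  intro j; fin_cases j <;> exact row_support_digitGrid
theorem vv_digitGrid : ∀ j, ∀ q ∈ (vv j).support, q ∈ DigitGrid 3 := by
  intro j; fin_cases j <;> exact row_support_digitGrid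

/-- THE WITNESS (`s = 3`, `m = 3`, base 2): a digit-grid instance with an LL-visible point `p = (2³,2³)` of class `(3,3)` whose
3-digit identity box `[0,2³)²` has truncated rows that NEITHER coincide as multisets NOR lie in an affine 2-plane. -/
theorem vandermondeDefect_witness :
    (∀ j, ∀ q ∈ (uu j).support, q ∈ DigitGrid 3) ∧ (∀ j, ∀ q ∈ (vv j).support, q ∈ DigitGrid 3) ∧
    pp ∈ llVisible uu vv ∧ pp 0 = 2 ^ 3 ∧ pp 1 = 2 ^ 3 ∧
    (Finset.univ.val.map fun j => boxTrunc (2 ^ 3) (2 ^ 3) (uu j)) ≠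
      (Finset.univ.val.map fun j => boxTrunc (2 ^ 3) (2 ^ 3) (vv j)) ∧
    ¬ AffRankLeTwo (2 ^ 3) (2 ^ 3) uu vv :=
  ⟨uu_digitGrid, vv_digitGrid, pp_mem_llVisible, by simp, by simp,
    by rw [show (2 : ℕ) ^ 3 = 8 by norm_num]; exact truncated_rows_ne,
    by rw [show (2 : ℕ) ^ 3 = 8 by norm_num]; exact not_affRankLeTwo⟩

/-! ## §2  The rigidity-or-rank-two dichotomy (D2) fails at `m = 3` -/

/-- D2 (val-idea-crit-8 g3, 2026-08-29T02:52:24Z), typed with the quantifier shape of `not_rowCoincidence_on_digitGrid`: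
«below every LL-visible point of a digit-grid instance the truncated rows coincide as multisets OR the truncated table has
affine rank ≤ 2».  FALSE: the Vandermonde-defect witness (class `(3,3)`, box `[0,8)²`). -/
theorem not_coincidence_or_affRankLeTwo :
    ¬ (∀ (m s : ℕ) (u v : Fin m → MvPolynomial (Fin 2) ℂ),
        (∀ j, ∀ e ∈ (u j).support, e ∈ DigitGrid s) → (∀ j, ∀ e ∈ (v j).support, e ∈ DigitGrid s) →
        ∀ p ∈ llVisible u v, ∀ N M : ℕ, N ≤ p 0 + 1 → M ≤ p 1 + 1 → (N ≤ p 0 ∨ M ≤ p 1) →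
          (Finset.univ.val.map fun j => boxTrunc N M (u j)) = (Finset.univ.val.map fun j => boxTrunc N M (v j)) ∨
          AffRankLeTwo N M u v) := by
  intro h
  rcases h 3 3 uu vv uu_digitGrid vv_digitGrid pp pp_mem_llVisible 8 8 (by simp) (by simp) (Or.inl (by simp)) with h | h
  · exact truncated_rows_ne h
  · exact not_affRankLeTwo h

/-! ## §3  Typed OPEN targets of the first-variation line (statements only; nothing asserted) -/

/-- LL-visible points of ONE polynomial: strict tops of its support for some weight in the open negative quadrant. -/
def llVisibleOf (P : MvPolynomial (Fin 2) ℂ) : Set Expo :=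
  {l | ∃ ξ : Fin 2 → ℝ, ξ 0 < 0 ∧ ξ 1 < 0 ∧ IsStrictTop ξ (↑P.support : Set Expo) l}

/-- The FIRST VARIATION of `∏_j (1 + u_j)` in the direction `τ`: `G_τ = Σ_j τ_j ∏_{i≠j} (1+u_i)`
(`= ∏(1+u) · Σ_j τ_j/(1+u_j)` in the completed ring; its LL-visible points are the vertices of the Newton polyhedron of the
resolvent sum `Σ_j τ_j (1+u_j)^{-1}`). -/
def firstVariation {m : ℕ} (u : Fin m → MvPolynomial (Fin 2) ℂ) (τ : Fin m → ℂ) : MvPolynomial (Fin 2) ℂ :=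
  ∑ j, C (τ j) * ∏ i ∈ Finset.univ.erase j, (1 + u i)

/-- LINEARISED DIGIT-GRID LL LAW (`s²` currency; OPEN, conjectural): the first variation of `m` digit-grid rows has at most
`C·m^c·s²` LL-visible points, for every weight vector `τ`.  Necessary for `DigitGridLLLaw` (via `FirstVariationTransfer`);
content only from `m = 6` on (the support lies in `T(s,m−1,2)`, whose LL ceiling is `≤ quadratic` for `m−1 ≤ 4`). -/
def LinearisedLLLaw : Prop :=
  ∃ C c : ℕ, ∀ (m s : ℕ) (u : Fin m → MvPolynomial (Fin 2) ℂ) (τ : Fin m → ℂ),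
    (∀ j, ∀ e ∈ (u j).support, e ∈ DigitGrid s) →
      (llVisibleOf (firstVariation u τ)).ncard ≤ C * m ^ c * s ^ 2

/-- LINEARISED DIGIT-GRID LL LAW, LINEAR currency (OPEN, conjectural; necessary for `DigitGridLLLawLinear`; content from `m = 4`:
`T(s,3,2)` has LL chains of length `s² − 3s + 6`). -/
def LinearisedLLLawLinear : Prop :=
  ∃ C c : ℕ, ∀ (m s : ℕ) (u : Fin m → MvPolynomial (Fin 2) ℂ) (τ : Fin m → ℂ),
    (∀ j, ∀ e ∈ (u j).support, e ∈ DigitGrid s) →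
      (llVisibleOf (firstVariation u τ)).ncard ≤ C * m ^ c * s

/-- The digit-grid LL law of record (U-shape of `SubboxCascade.DigitGridLLLaw`, restated over the imported verbatim defs; OPEN). -/
def DigitGridLLLaw' : Prop :=
  ∃ C c : ℕ, ∀ (m s : ℕ) (u v : Fin m → MvPolynomial (Fin 2) ℂ),
    (∀ j, ∀ e ∈ (u j).support, e ∈ DigitGrid s) → (∀ j, ∀ e ∈ (v j).support, e ∈ DigitGrid s) →
      (llVisible u v).ncard ≤ C * m ^ c * s ^ 2

/-- FIRST-VARIATION TRANSFER (paper-proved in the note, §3; Lean size M): with `t = (2^S, 1)`, `S ≥ 2s + 2 log₂ m + 2`, and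
`v_j = u_j + τ_j X^t`, every LL-vertex `q` of `Γ₊(G_τ)` gives the LL-visible point `t + q` of `∏(1+u) − ∏(1+v)` (the strips
`k·t + supp G_k` are separated in `x`, and the slope threshold `m·2^{s−S}` is below every edge slope of `Γ₊(G_τ)`), so the
two-products law bounds the linearised count with `s ↦ S + 1`.  Stated as an implication between the typed laws. -/
def FirstVariationTransfer : Prop := DigitGridLLLaw' → LinearisedLLLaw


/-! ## §4  FIRST RUNG of the cancellation ladder for `llVisibleOf (firstVariation u τ)` (rev 2; LIN-T v1 read-out §4(b),
accepted on paper by val-idea-crit-8 g3 2026-08-29T03:45:15Z; kernel here)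

Informal statement.  Let `W = ⋃_j supp u_j ⊆ A_s` and `Σ τ = 0`.  If for every LL direction `ξ` (both coordinates negative) some
`ξ`-maximal letter `v ∈ W` has its DOUBLE alive in `G_τ` (`coeff (2v) G_τ ≠ 0` — the «order-2 quantity» `τ·c_v² − [P₁]_{2v}` of the
read-out when `v` is a hull vertex), then every LL-visible point of `G_τ` is a letter of `W` or a doubled letter `2v`, hence (distinct
`x`-coordinates, all in `{1, 2, …, 2^s}`) there are at most `s + 1` of them.  So every count above `s + 1` at ANY `m` requires an
order-2 cancellation at a `ξ`-maximal letter for some direction `ξ` — exactly what the type-2 («order-2-null») columns of the LIN-T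
maximisers supply.  The hull-vertex wording of the read-out implies the direction-wise hypothesis used here by elementary convexity
(a face of maximisers has a vertex endpoint); the all-letters wording (`firstRung_of_forall`) implies it trivially. -/

/-- `wt` is additive. -/
theorem wt_add' (ξ : Fin 2 → ℝ) (a b : Expo) : wt ξ (a + b) = wt ξ a + wt ξ b := by
  unfold wt
  simp only [Finsupp.add_apply, Nat.cast_add]
  ring

/-- `wt` of a doubled exponent. -/
theorem wt_two_nsmul (ξ : Fin 2 → ℝ) (v : Expo) : wt ξ (2 • v) = 2 * wt ξ v := by
  unfold wt
  simp only [Finsupp.smul_apply, smul_eq_mul, Nat.cast_mul, Nat.cast_ofNat]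
  ring

/-- `wt` is antitone for weights in the closed negative quadrant. -/
theorem wt_anti (ξ : Fin 2 → ℝ) (h0 : ξ 0 ≤ 0) (h1 : ξ 1 ≤ 0) {a n : Expo} (h : a ≤ n) : wt ξ n ≤ wt ξ a := by
  unfold wt
  have ha0 : ((a 0 : ℕ) : ℝ) ≤ ((n 0 : ℕ) : ℝ) := by exact_mod_cast h 0
  have ha1 : ((a 1 : ℕ) : ℝ) ≤ ((n 1 : ℕ) : ℝ) := by exact_mod_cast h 1
  have c0 := mul_le_mul_of_nonpos_left ha0 h0
  have c1 := mul_le_mul_of_nonpos_left ha1 h1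
  linarith

/-- Two distinct LL-visible points of one polynomial have distinct `x`-coordinates. -/
theorem llVisibleOf_injOn_fst (P : MvPolynomial (Fin 2) ℂ) :
    Set.InjOn (fun e : Expo => e 0) (llVisibleOf P) := by
  intro p hp q hq hpq
  dsimp only at hpq
  obtain ⟨ξ, hξ0, hξ1, hptop⟩ := hp
  obtain ⟨ζ, hζ0, hζ1, hqtop⟩ := hq
  by_contra hne
  have hpS : p ∈ (↑P.support : Set Expo) := hptop.1
  have hqS : q ∈ (↑P.support : Set Expo) := hqtop.1
  have h1ne : p 1 ≠ q 1 := by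
    intro h
    apply hne
    ext i
    fin_cases i
    · exact hpq
    · exact h
  rcases Nat.lt_or_gt_of_ne h1ne with hlt | hgt
  · have hw := hqtop.2 p hpS hne
    unfold wt at hw
    have c0 : ((p 0 : ℕ) : ℝ) = ((q 0 : ℕ) : ℝ) := by exact_mod_cast hpq
    have c0' : ζ 0 * ((p 0 : ℕ) : ℝ) = ζ 0 * ((q 0 : ℕ) : ℝ) := by rw [c0]
    have c1 : ((p 1 : ℕ) : ℝ) < ((q 1 : ℕ) : ℝ) := by exact_mod_cast hlt
    have c2 := mul_lt_mul_of_neg_left c1 hζ1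
    linarith
  · have hw := hptop.2 q hqS (Ne.symm hne)
    unfold wt at hw
    have c0 : ((p 0 : ℕ) : ℝ) = ((q 0 : ℕ) : ℝ) := by exact_mod_cast hpq
    have c0' : ξ 0 * ((p 0 : ℕ) : ℝ) = ξ 0 * ((q 0 : ℕ) : ℝ) := by rw [c0]
    have c1 : ((q 1 : ℕ) : ℝ) < ((p 1 : ℕ) : ℝ) := by exact_mod_cast hgt
    have c2 := mul_lt_mul_of_neg_left c1 hξ1
    linarith

/-- ABSTRACT FIRST RUNG.  `G` any polynomial whose support points are letters of `W` or dominate a sum of two letters of `W`;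
if for every LL direction some `ξ`-maximal letter of `W` has its double in `supp G`, then every LL-visible point of `G` is a
letter of `W` or a doubled letter. -/
theorem llVisibleOf_subset_letters_or_doubles (G : MvPolynomial (Fin 2) ℂ) (W : Finset Expo)
    (hsupp : ∀ n ∈ G.support, n ∈ W ∨ ∃ a ∈ W, ∃ b ∈ W, a + b ≤ n)
    (hlive : ∀ ξ : Fin 2 → ℝ, ξ 0 < 0 → ξ 1 < 0 → W.Nonempty →
      ∃ v ∈ W, (∀ w ∈ W, wt ξ w ≤ wt ξ v) ∧ coeff (2 • v) G ≠ 0) :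
    llVisibleOf G ⊆ (↑W : Set Expo) ∪ (fun v : Expo => 2 • v) '' (↑W : Set Expo) := by
  intro n hn
  obtain ⟨ξ, hξ0, hξ1, hnS, htop⟩ := hn
  have hnsupp : n ∈ G.support := Finset.mem_coe.1 hnS
  rcases hsupp n hnsupp with hW | ⟨a, ha, b, hb, hab⟩
  · exact Or.inl (Finset.mem_coe.2 hW)
  · obtain ⟨v, hv, hmax, hcoeff⟩ := hlive ξ hξ0 hξ1 ⟨a, ha⟩
    by_cases hnv : n = 2 • v
    · exact Or.inr ⟨v, Finset.mem_coe.2 hv, hnv.symm⟩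
    · exfalso
      have h2vS : (2 • v) ∈ (↑G.support : Set Expo) := Finset.mem_coe.2 (mem_support_iff.2 hcoeff)
      have hlt := htop (2 • v) h2vS (fun h => hnv h.symm)
      have h1 : wt ξ n ≤ wt ξ (a + b) := wt_anti ξ hξ0.le hξ1.le hab
      have h2 : wt ξ (a + b) = wt ξ a + wt ξ b := wt_add' ξ a b
      have h3 := hmax a ha
      have h4 := hmax b hb
      have h5 : wt ξ (2 • v) = 2 * wt ξ v := wt_two_nsmul ξ v
      linarith

/-- COUNT.  Under the hypotheses of the abstract first rung and `W ⊆ A_s`: at most `s + 1` LL-visible points. -/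
theorem ncard_llVisibleOf_le_succ (G : MvPolynomial (Fin 2) ℂ) (W : Finset Expo) (s : ℕ)
    (hW : ∀ e ∈ W, e ∈ DigitGrid s)
    (hsupp : ∀ n ∈ G.support, n ∈ W ∨ ∃ a ∈ W, ∃ b ∈ W, a + b ≤ n)
    (hlive : ∀ ξ : Fin 2 → ℝ, ξ 0 < 0 → ξ 1 < 0 → W.Nonempty →
      ∃ v ∈ W, (∀ w ∈ W, wt ξ w ≤ wt ξ v) ∧ coeff (2 • v) G ≠ 0) :
    (llVisibleOf G).ncard ≤ s + 1 := by
  classical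
  have hsub := llVisibleOf_subset_letters_or_doubles G W hsupp hlive
  have hmaps : ∀ e ∈ llVisibleOf G,
      (fun e : Expo => e 0) e ∈ (↑((Finset.range (s + 1)).image (fun a => 2 ^ a)) : Set ℕ) := by
    intro e he
    rw [Finset.coe_image]
    rcases hsub he with h | ⟨v, hv, hve⟩
    · obtain ⟨a, b, ha, hb, h0, h1⟩ := hW e (Finset.mem_coe.1 h)
      exact ⟨a, by simp; omega, h0.symm⟩
    · obtain ⟨a, b, ha, hb, h0, h1⟩ := hW v (Finset.mem_coe.1 hv)
      refine ⟨a + 1, by simp; omega, ?_⟩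
      have : e 0 = 2 * v 0 := by rw [← hve]; simp
      show 2 ^ (a + 1) = e 0
      rw [this, h0]
      ring
  have h := Set.ncard_le_ncard_of_injOn (fun e : Expo => e 0) hmaps (llVisibleOf_injOn_fst G)
    (Finset.finite_toSet _)
  rw [Set.ncard_coe_finset] at h
  have h' := h.trans (Finset.card_image_le.trans (Finset.card_range (s + 1)).le)
  simpa using h'

/-- Support of `∏_{i ∈ S} (1 + u_i)`: every exponent is `0`, a letter of `W ⊇ ⋃ supp u_i`, or dominates a sum of two letters. -/
theorem support_prod_one_add {m : ℕ} (W : Finset Expo) (u : Fin m → MvPolynomial (Fin 2) ℂ)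
    (hW : ∀ i, (u i).support ⊆ W) (S : Finset (Fin m)) :
    ∀ n ∈ (∏ i ∈ S, (1 + u i)).support, n = 0 ∨ n ∈ W ∨ ∃ a ∈ W, ∃ b ∈ W, a + b ≤ n := by
  classical
  induction S using Finset.induction_on with
  | empty =>
    intro n hn
    rw [Finset.prod_empty] at hn
    have h := mem_support_iff.1 hn
    rw [coeff_one] at h
    by_cases hn0 : n = 0
    · exact Or.inl hn0
    · exact absurd (if_neg (fun h' => hn0 h'.symm)) h
  | @insert i S hi ih =>
    intro n hn
    rw [Finset.prod_insert hi] at hn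
    have hmul := support_mul _ _ hn
    rw [Finset.mem_add] at hmul
    obtain ⟨e, he, n', hn', rfl⟩ := hmul
    have ih' := ih n' hn'
    have he' : e = 0 ∨ e ∈ W := by
      have := support_add he
      rw [Finset.mem_union] at this
      rcases this with h1 | h2
      · have h := mem_support_iff.1 h1
        rw [coeff_one] at h
        by_cases he0 : e = 0
        · exact Or.inl he0
        · exact absurd (if_neg (fun h' => he0 h'.symm)) h
      · exact Or.inr (hW i h2)
    rcases he' with rfl | heW
    · simpa using ih'
    · rcases ih' with rfl | hn'W | ⟨a, ha, b, hb, hab⟩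
      · right; left; simpa using heW
      · right; right
        exact ⟨e, heW, n', hn'W, le_rfl⟩
      · right; right
        refine ⟨a, ha, b, hb, hab.trans ?_⟩
        intro k
        simp only [Finsupp.add_apply]
        omega

/-- The constant coefficient of the first variation of rows without constant term is `Σ_j τ_j`. -/
theorem constantCoeff_firstVariation {m : ℕ} (u : Fin m → MvPolynomial (Fin 2) ℂ) (τ : Fin m → ℂ)
    (hu0 : ∀ j, coeff 0 (u j) = 0) : constantCoeff (firstVariation u τ) = ∑ j, τ j := by
  classical
  have h0 : ∀ i, constantCoeff (u i) = 0 := fun i => by rw [constantCoeff_eq]; exact hu0 i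
  unfold firstVariation
  simp [map_sum, map_mul, map_prod, h0]

/-- Support of the first variation when `Σ τ = 0` and the rows have no constant term: letters of `W` or dominating a sum of two. -/
theorem support_firstVariation {m : ℕ} (W : Finset Expo) (u : Fin m → MvPolynomial (Fin 2) ℂ) (τ : Fin m → ℂ)
    (hW : ∀ i, (u i).support ⊆ W) (hu0 : ∀ j, coeff 0 (u j) = 0) (hτ : ∑ j, τ j = 0) :
    ∀ n ∈ (firstVariation u τ).support, n ∈ W ∨ ∃ a ∈ W, ∃ b ∈ W, a + b ≤ n := by
  classical
  intro n hn
  have hn0 : n ≠ 0 := by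
    intro h
    subst h
    have hc := mem_support_iff.1 hn
    have : coeff 0 (firstVariation u τ) = ∑ j, τ j := by
      rw [← constantCoeff_eq]; exact constantCoeff_firstVariation u τ hu0
    exact hc (this.trans hτ)
  -- `n` lies in the support of one of the summands, hence of one of the products
  have hsum : ∃ j, n ∈ (∏ i ∈ Finset.univ.erase j, (1 + u i)).support := by
    unfold firstVariation at hn
    obtain ⟨j, -, hj⟩ := Finset.mem_biUnion.1 (support_sum hn)
    refine ⟨j, ?_⟩
    by_contra hnot
    have hz : coeff n (∏ i ∈ Finset.univ.erase j, (1 + u i)) = 0 := by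
      by_contra hz
      exact hnot (mem_support_iff.2 hz)
    have := mem_support_iff.1 hj
    rw [coeff_C_mul, hz, mul_zero] at this
    exact this rfl
  obtain ⟨j, hj⟩ := hsum
  rcases support_prod_one_add W u hW (Finset.univ.erase j) n hj with h | h | h
  · exact absurd h hn0
  · exact Or.inl h
  · exact Or.inr h

/-- Rows on the digit grid have no constant term. -/
theorem coeff_zero_of_digitGrid {m : ℕ} (s : ℕ) (u : Fin m → MvPolynomial (Fin 2) ℂ)
    (hu : ∀ j, ∀ e ∈ (u j).support, e ∈ DigitGrid s) (j : Fin m) : coeff 0 (u j) = 0 := by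
  by_contra h
  obtain ⟨a, b, -, -, h0, -⟩ := hu j 0 (mem_support_iff.2 h)
  have : (0 : Expo) 0 = 0 := rfl
  rw [this] at h0
  exact absurd h0.symm (pow_ne_zero a two_ne_zero)

/-- FIRST RUNG (direction-wise form).  Rows on `A_s`, `Σ τ = 0`; if for every LL direction `ξ` some `ξ`-maximal letter `v` of
`W = ⋃ supp u_j` has `coeff (2v) (firstVariation u τ) ≠ 0`, then `#llVisibleOf (firstVariation u τ) ≤ s + 1`. -/
theorem firstRung {m : ℕ} (s : ℕ) (u : Fin m → MvPolynomial (Fin 2) ℂ) (τ : Fin m → ℂ)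
    (hu : ∀ j, ∀ e ∈ (u j).support, e ∈ DigitGrid s) (hτ : ∑ j, τ j = 0)
    (hlive : ∀ ξ : Fin 2 → ℝ, ξ 0 < 0 → ξ 1 < 0 → (∃ j, (u j).support.Nonempty) →
      ∃ j, ∃ v ∈ (u j).support, (∀ i, ∀ w ∈ (u i).support, wt ξ w ≤ wt ξ v) ∧
        coeff (2 • v) (firstVariation u τ) ≠ 0) :
    (llVisibleOf (firstVariation u τ)).ncard ≤ s + 1 := by
  classical
  set W : Finset Expo := Finset.univ.biUnion (fun j => (u j).support) with hWdef
  have hWsub : ∀ i, (u i).support ⊆ W := fun i e he => Finset.mem_biUnion.2 ⟨i, Finset.mem_univ i, he⟩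
  have hWgrid : ∀ e ∈ W, e ∈ DigitGrid s := by
    intro e he
    obtain ⟨j, -, hj⟩ := Finset.mem_biUnion.1 he
    exact hu j e hj
  refine ncard_llVisibleOf_le_succ (firstVariation u τ) W s hWgrid
    (support_firstVariation W u τ hWsub (coeff_zero_of_digitGrid s u hu) hτ) ?_
  intro ξ hξ0 hξ1 hne
  obtain ⟨e, he⟩ := hne
  obtain ⟨j0, -, hj0⟩ := Finset.mem_biUnion.1 he
  obtain ⟨j, v, hv, hmax, hc⟩ := hlive ξ hξ0 hξ1 ⟨j0, ⟨e, hj0⟩⟩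
  refine ⟨v, hWsub j hv, ?_, hc⟩
  intro w hw
  obtain ⟨i, -, hi⟩ := Finset.mem_biUnion.1 hw
  exact hmax i w hi

/-- FIRST RUNG (all-letters form): if NO doubled letter cancels in the first variation, `#llVisibleOf ≤ s + 1`. -/
theorem firstRung_of_forall {m : ℕ} (s : ℕ) (u : Fin m → MvPolynomial (Fin 2) ℂ) (τ : Fin m → ℂ)
    (hu : ∀ j, ∀ e ∈ (u j).support, e ∈ DigitGrid s) (hτ : ∑ j, τ j = 0)
    (hall : ∀ j, ∀ v ∈ (u j).support, coeff (2 • v) (firstVariation u τ) ≠ 0) :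
    (llVisibleOf (firstVariation u τ)).ncard ≤ s + 1 := by
  classical
  refine firstRung s u τ hu hτ ?_
  intro ξ hξ0 hξ1 hne
  set W : Finset Expo := Finset.univ.biUnion (fun j => (u j).support) with hWdef
  have hWne : W.Nonempty := by
    obtain ⟨j, e, he⟩ := hne
    exact ⟨e, Finset.mem_biUnion.2 ⟨j, Finset.mem_univ j, he⟩⟩
  obtain ⟨v, hv, hmax⟩ := Finset.exists_max_image W (fun w => wt ξ w) hWne
  obtain ⟨j, -, hj⟩ := Finset.mem_biUnion.1 hv
  refine ⟨j, v, hj, ?_, hall j v hj⟩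
  intro i w hw
  exact hmax w (Finset.mem_biUnion.2 ⟨i, Finset.mem_univ i, hw⟩)


/-! ## §5  LADDER CONTAINMENT at level `k` (rev 3) — «what one more order of cancellation can free»

Informal statement.  Let `W` be the letters.  Suppose every support point of `G` is either in a «low» set `L` or dominates a
sum of at least `k+1` letters (for `G_τ`: `L` = sums of ≤ k letters from distinct rows), and suppose that for every LL direction
`ξ` some `ξ`-maximal letter `d` has SOME pure multiple `i•d`, `1 ≤ i ≤ k+1`, alive in `G`.  Then every LL-visible point of `G`
lies in `L ∪ {i•d : d ∈ W, 1 ≤ i ≤ k+1}`.  (Proof: a visible point outside `L` has weight ≤ (k+1)·wt d ≤ i·wt d = wt(i•d), and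
`i•d` is in the support — contradiction with strict maximality unless they coincide.)  Level `k = 1` is §4.  READING for the
linearised law: a count above the LL-chain ceiling of the level-`k` set `T(s,k,2) ∪ {i•A_s}` forces, for some direction, ALL
pure multiples `d, 2d, …, (k+1)d` of every maximal letter to be cancelled — at `m = 4` an order-3 pure-power null
`τ·c_d = τ·c_d² = τ·c_d³ = 0` already pins the column `c_d` to finitely many directions (Bézout; for paired `τ_j = −τ_{j'}`
these include the all-order-null paired columns `(p,q,p,q)`).  The level-2 count is then the 2-bit chain ceiling (data
`L_LL(T(s,2,2)) = 4s − 9`, val-idea-34 g10 N4) — typed below as `TwoBitChainCeiling`; PROVED (C = 8) in §6, rev 4. -/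

/-- `wt` of an `i`-fold multiple. -/
theorem wt_nsmul (ξ : Fin 2 → ℝ) (i : ℕ) (v : Expo) : wt ξ (i • v) = (i : ℝ) * wt ξ v := by
  unfold wt
  simp only [Finsupp.smul_apply, smul_eq_mul, Nat.cast_mul]
  ring

/-- `wt` of the origin. -/
theorem wt_zero (ξ : Fin 2 → ℝ) : wt ξ 0 = 0 := by
  unfold wt
  simp

/-- `wt` of a multiset sum. -/
theorem wt_multiset_sum (ξ : Fin 2 → ℝ) (M : Multiset Expo) : wt ξ M.sum = (M.map (wt ξ)).sum := by
  induction M using Multiset.induction_on with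
  | empty => simp [wt_zero]
  | cons a M ih => rw [Multiset.sum_cons, Multiset.map_cons, Multiset.sum_cons, wt_add', ih]

/-- A multiset of reals each `≤ c` has sum `≤ card • c`. -/
theorem multiset_sum_le_card_mul (M : Multiset ℝ) (c : ℝ) (h : ∀ x ∈ M, x ≤ c) :
    M.sum ≤ (Multiset.card M : ℝ) * c := by
  induction M using Multiset.induction_on with
  | empty => simp
  | cons a M ih =>
    rw [Multiset.sum_cons, Multiset.card_cons]
    have ha := h a (Multiset.mem_cons_self a M)
    have hM := ih (fun x hx => h x (Multiset.mem_cons_of_mem hx))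
    push_cast
    linarith

/-- Letters have non-positive weight in LL directions. -/
theorem wt_nonpos (ξ : Fin 2 → ℝ) (h0 : ξ 0 ≤ 0) (h1 : ξ 1 ≤ 0) (e : Expo) : wt ξ e ≤ 0 := by
  have h := wt_anti ξ h0 h1 (show (0 : Expo) ≤ e from bot_le)
  rwa [wt_zero] at h

/-- LADDER CONTAINMENT (abstract, level `k`).  Support points of `G` are «low» (in `L`) or dominate a sum of ≥ k+1 letters of
`W`; at every LL direction some maximal letter has a live pure multiple of order ≤ k+1; then the LL-visible points are low or
pure multiples of letters of order ≤ k+1. -/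
theorem ladderContainment (G : MvPolynomial (Fin 2) ℂ) (W : Finset Expo) (L : Set Expo) (k : ℕ)
    (hsupp : ∀ n ∈ G.support, n ∈ L ∨ ∃ M : Multiset Expo, (∀ a ∈ M, a ∈ W) ∧ k + 1 ≤ Multiset.card M ∧ M.sum ≤ n)
    (hlive : ∀ ξ : Fin 2 → ℝ, ξ 0 < 0 → ξ 1 < 0 → W.Nonempty →
      ∃ d ∈ W, (∀ w ∈ W, wt ξ w ≤ wt ξ d) ∧ ∃ i : ℕ, 1 ≤ i ∧ i ≤ k + 1 ∧ coeff (i • d) G ≠ 0) :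
    llVisibleOf G ⊆ L ∪ {n | ∃ d ∈ W, ∃ i : ℕ, 1 ≤ i ∧ i ≤ k + 1 ∧ n = i • d} := by
  intro n hn
  obtain ⟨ξ, hξ0, hξ1, hnS, htop⟩ := hn
  have hnsupp : n ∈ G.support := Finset.mem_coe.1 hnS
  rcases hsupp n hnsupp with hL | ⟨M, hMW, hcard, hsum⟩
  · exact Or.inl hL
  · have hWne : W.Nonempty := by
      have hMne : M ≠ 0 := by
        intro h; subst h; simp at hcard
      obtain ⟨a, ha⟩ := Multiset.exists_mem_of_ne_zero hMne
      exact ⟨a, hMW a ha⟩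
    obtain ⟨d, hd, hmax, i, hi1, hik, hcoeff⟩ := hlive ξ hξ0 hξ1 hWne
    by_cases hnd : n = i • d
    · exact Or.inr ⟨d, hd, i, hi1, hik, hnd⟩
    · exfalso
      have hidS : (i • d) ∈ (↑G.support : Set Expo) := Finset.mem_coe.2 (mem_support_iff.2 hcoeff)
      have hlt := htop (i • d) hidS (fun h => hnd h.symm)
      -- wt n ≤ wt (M.sum) = Σ wt ≤ card M * wt d ≤ (k+1) * wt d ≤ i * wt d = wt (i • d)
      have h1 : wt ξ n ≤ wt ξ M.sum := wt_anti ξ hξ0.le hξ1.le hsum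
      have h2 : wt ξ M.sum = (M.map (wt ξ)).sum := wt_multiset_sum ξ M
      have h3 : (M.map (wt ξ)).sum ≤ (Multiset.card (M.map (wt ξ)) : ℝ) * wt ξ d := by
        apply multiset_sum_le_card_mul
        intro x hx
        obtain ⟨a, ha, rfl⟩ := Multiset.mem_map.1 hx
        exact hmax a (hMW a ha)
      rw [Multiset.card_map] at h3
      have hd0 : wt ξ d ≤ 0 := wt_nonpos ξ hξ0.le hξ1.le d
      have hcard' : ((k : ℝ) + 1) ≤ (Multiset.card M : ℝ) := by exact_mod_cast hcard
      have hik' : (i : ℝ) ≤ (k : ℝ) + 1 := by exact_mod_cast hik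
      have h4 : (Multiset.card M : ℝ) * wt ξ d ≤ ((k : ℝ) + 1) * wt ξ d := mul_le_mul_of_nonpos_right hcard' hd0
      have h5 : ((k : ℝ) + 1) * wt ξ d ≤ (i : ℝ) * wt ξ d := mul_le_mul_of_nonpos_right hik' hd0
      have h6 : wt ξ (i • d) = (i : ℝ) * wt ξ d := wt_nsmul ξ i d
      linarith

/-- Support of `∏_{i ∈ S} (1 + u_i)`: every exponent is the sum of a multiset of letters of `W` (one from each row used). -/
theorem support_prod_one_add_multiset {m : ℕ} (W : Finset Expo) (u : Fin m → MvPolynomial (Fin 2) ℂ)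
    (hW : ∀ i, (u i).support ⊆ W) (S : Finset (Fin m)) :
    ∀ n ∈ (∏ i ∈ S, (1 + u i)).support, ∃ M : Multiset Expo, (∀ a ∈ M, a ∈ W) ∧ M.sum = n := by
  classical
  induction S using Finset.induction_on with
  | empty =>
    intro n hn
    rw [Finset.prod_empty] at hn
    have h := mem_support_iff.1 hn
    rw [coeff_one] at h
    by_cases hn0 : n = 0
    · exact ⟨0, by simp, by simp [hn0]⟩
    · exact absurd (if_neg (fun h' => hn0 h'.symm)) h
  | @insert i S hi ih =>
    intro n hn
    rw [Finset.prod_insert hi] at hn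
    have hmul := support_mul _ _ hn
    rw [Finset.mem_add] at hmul
    obtain ⟨e, he, n', hn', rfl⟩ := hmul
    obtain ⟨M, hMW, hMsum⟩ := ih n' hn'
    have he' : e = 0 ∨ e ∈ W := by
      have := support_add he
      rw [Finset.mem_union] at this
      rcases this with h1 | h2
      · have h := mem_support_iff.1 h1
        rw [coeff_one] at h
        by_cases he0 : e = 0
        · exact Or.inl he0
        · exact absurd (if_neg (fun h' => he0 h'.symm)) h
      · exact Or.inr (hW i h2)
    rcases he' with rfl | heW
    · exact ⟨M, hMW, by simp [hMsum]⟩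
    · refine ⟨e ::ₘ M, ?_, ?_⟩
      · intro a ha
        rcases Multiset.mem_cons.1 ha with rfl | ha'
        · exact heW
        · exact hMW a ha'
      · rw [Multiset.sum_cons, hMsum]

/-- The «low» set of level `k`: sums of at most `k` letters of `W`. -/
def lowSums (W : Finset Expo) (k : ℕ) : Set Expo :=
  {n | ∃ M : Multiset Expo, (∀ a ∈ M, a ∈ W) ∧ Multiset.card M ≤ k ∧ M.sum = n}

/-- Support of the first variation, level-`k` reading: a sum of ≤ k letters, or dominating (indeed equal to) a sum of ≥ k+1. -/
theorem support_firstVariation_level {m : ℕ} (W : Finset Expo) (u : Fin m → MvPolynomial (Fin 2) ℂ) (τ : Fin m → ℂ)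
    (hW : ∀ i, (u i).support ⊆ W) (k : ℕ) :
    ∀ n ∈ (firstVariation u τ).support,
      n ∈ lowSums W k ∨ ∃ M : Multiset Expo, (∀ a ∈ M, a ∈ W) ∧ k + 1 ≤ Multiset.card M ∧ M.sum ≤ n := by
  classical
  intro n hn
  have hsum : ∃ j, n ∈ (∏ i ∈ Finset.univ.erase j, (1 + u i)).support := by
    unfold firstVariation at hn
    obtain ⟨j, -, hj⟩ := Finset.mem_biUnion.1 (support_sum hn)
    refine ⟨j, ?_⟩
    by_contra hnot
    have hz : coeff n (∏ i ∈ Finset.univ.erase j, (1 + u i)) = 0 := by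
      by_contra hz
      exact hnot (mem_support_iff.2 hz)
    have := mem_support_iff.1 hj
    rw [coeff_C_mul, hz, mul_zero] at this
    exact this rfl
  obtain ⟨j, hj⟩ := hsum
  obtain ⟨M, hMW, hMsum⟩ := support_prod_one_add_multiset W u hW (Finset.univ.erase j) n hj
  by_cases hc : Multiset.card M ≤ k
  · exact Or.inl ⟨M, hMW, hc, hMsum⟩
  · exact Or.inr ⟨M, hMW, by omega, hMsum.le⟩

/-- LADDER CONTAINMENT for the first variation (level `k`, any `m`, any supports): if at every LL direction some maximal letter
`d` of `W = ⋃ supp u_j` has a live pure multiple `i•d` (`1 ≤ i ≤ k+1`) in `firstVariation u τ`, then every LL-visible point is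
a sum of ≤ k letters or such a pure multiple.  Level 1 + the digit grid gives §4 (`firstRung`). -/
theorem ladderContainment_firstVariation {m : ℕ} (k : ℕ) (u : Fin m → MvPolynomial (Fin 2) ℂ) (τ : Fin m → ℂ)
    (hlive : ∀ ξ : Fin 2 → ℝ, ξ 0 < 0 → ξ 1 < 0 → (∃ j, (u j).support.Nonempty) →
      ∃ j, ∃ d ∈ (u j).support, (∀ i, ∀ w ∈ (u i).support, wt ξ w ≤ wt ξ d) ∧
        ∃ i : ℕ, 1 ≤ i ∧ i ≤ k + 1 ∧ coeff (i • d) (firstVariation u τ) ≠ 0) :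
    llVisibleOf (firstVariation u τ) ⊆
      lowSums (Finset.univ.biUnion (fun j => (u j).support)) k ∪
        {n | ∃ d ∈ Finset.univ.biUnion (fun j => (u j).support), ∃ i : ℕ, 1 ≤ i ∧ i ≤ k + 1 ∧ n = i • d} := by
  classical
  set W : Finset Expo := Finset.univ.biUnion (fun j => (u j).support) with hWdef
  have hWsub : ∀ i, (u i).support ⊆ W := fun i e he => Finset.mem_biUnion.2 ⟨i, Finset.mem_univ i, he⟩
  refine ladderContainment (firstVariation u τ) W (lowSums W k) k (support_firstVariation_level W u τ hWsub k) ?_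
  intro ξ hξ0 hξ1 hne
  obtain ⟨e, he⟩ := hne
  obtain ⟨j0, -, hj0⟩ := Finset.mem_biUnion.1 he
  obtain ⟨j, d, hd, hmax, i, hi1, hik, hc⟩ := hlive ξ hξ0 hξ1 ⟨j0, ⟨e, hj0⟩⟩
  refine ⟨d, hWsub j hd, ?_, i, hi1, hik, hc⟩
  intro w hw
  obtain ⟨i', -, hi'⟩ := Finset.mem_biUnion.1 hw
  exact hmax i' w hi'

/-- The level-2 set: points whose coordinates have at most two binary digits `2^a + 2^b`, `a, b ≤ s` (this contains the
letters' doubles `2^(a+1)`, the 2-sums of letters of `A_s`, AND the triples `3·2^a = 2^a + 2^(a+1)`). -/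
def LevelTwoSet (s : ℕ) : Set Expo :=
  {n | ∃ a b c d : ℕ, a ≤ s ∧ b ≤ s ∧ c ≤ s ∧ d ≤ s ∧ n 0 = 2 ^ a + 2 ^ b ∧ n 1 = 2 ^ c + 2 ^ d}

/-- TYPED in rev 3, PROVED in §6 (rev 4, `twoBitChainCeiling_holds`, C = 8) — the level-2 geometric ceiling.  DATA (exact longest-LL-chain DP, seat script `g11/level2_ceiling.py`
over `g10/llfast.py`): the longest LL-convex chain inside `LevelTwoSet s` has 12, 15, 19, 22, 27, 31, 35, 39 points for
s = 4, …, 11, i.e. `4s − 5` for 8 ≤ s ≤ 11 (= val-idea-34 g10 N4's `L_LL(T(s,2,2)) = 4s − 9` with the index shifted by one) —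
LINEAR.  With it, level-2 ladder containment on the digit grid `A_s` gives `#llVisibleOf (firstVariation u τ) ≤ C·(s+1)` whenever
every LL direction has a maximal letter with a live double OR a live triple; so a super-linear count at `m = 4` needs, for some
direction, order-3 pure-power nulls `τ·c_d = τ·c_d² = τ·c_d³ = 0` at every maximal letter `d`. -/
def TwoBitChainCeiling : Prop :=
  ∃ C : ℕ, ∀ s : ℕ, ∀ P : MvPolynomial (Fin 2) ℂ, (↑P.support : Set Expo) ⊆ LevelTwoSet s →
    (llVisibleOf P).ncard ≤ C * (s + 1)

/-! ## §6 (rev 4–6, val-idea-34 g12) THE 2-BIT CHAIN CEILING — KERNEL: `twoBitChainCeiling_holds` (C = 8); SECOND RUNG `secondRung` (6.6)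

PAPER PROOF.  `V = llVisibleOf P` is an antichain whose consecutive edge slopes strictly decrease (exposure by a
weight in the open negative quadrant).  The BLOCK of a point is the pair of binary levels `(⌊log₂ q₀⌋, ⌊log₂ q₁⌋)`;
along `V` (x increasing) the x-level rises and the y-level falls, so `T(q) = xl + (s+2−yl)` is monotone and injective
on the block-FIRST points (`≤ 2s+2` of them).  Inside a block both residues `q₀ − 2^xl`, `q₁ − 2^yl` are `0` or a
SINGLE power of two, whence the GAP LEMMA: same-level 2-bit numbers `x < x'` satisfy `r'/2 ≤ x' − x ≤ r'`
(`r'` = residue of `x'`).  For a non-first point `q` with in-block predecessor `p` put `n(q) = log₂ rx(q) − log₂ ry(p)`;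
the gap lemma turns the slope comparison `Δy·Δx' > Δy'·Δx` of two edges into `n(q') ≥ n(q) − 1`, and inside one
block `n` rises by `≥ 2`; so `Φ = n + 2T` is strictly increasing along `V` on the non-first points, which are
therefore `≤ 6(s+1)` (range of `Φ`).  Total `≤ 8(s+1)`.  (Why level 2 is linear while level 3 is quadratic —
val-idea-34 g10 N4 `s² − 3s + 6`: level-3 in-block residues are 2-bit numbers with unit gaps; no gap lemma.) -/

namespace TwoBit

/-! ### 6.1  Arithmetic of 2-bit numbers -/

/-- `x = 2^a + 2^b` with `a, b ≤ s`. -/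
def IsTwoBit (s x : ℕ) : Prop := ∃ a b : ℕ, a ≤ s ∧ b ≤ s ∧ x = 2 ^ a + 2 ^ b

/-- binary level `⌊log₂ x⌋`. -/
def lv (x : ℕ) : ℕ := Nat.log 2 x

/-- residue below the leading bit. -/
def rs (x : ℕ) : ℕ := x - 2 ^ lv x

theorem lv_pow (L : ℕ) : lv (2 ^ L) = L := by
  unfold lv
  exact Nat.log_pow (by norm_num) L

theorem lv_pow_add {L e : ℕ} (h : e < L) : lv (2 ^ L + 2 ^ e) = L := by
  unfold lv
  have h1 : 2 ^ e < 2 ^ L := Nat.pow_lt_pow_right (by norm_num) h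
  apply Nat.log_eq_of_pow_le_of_lt_pow
  · exact Nat.le_add_right _ _
  · rw [pow_succ]
    omega

/-- Normal form: a pure power `2^L` (`1 ≤ L ≤ s+1`) or `2^L + 2^e` with `e < L ≤ s`. -/
theorem twoBit_cases {s x : ℕ} (hx : IsTwoBit s x) :
    (∃ L, 1 ≤ L ∧ L ≤ s + 1 ∧ x = 2 ^ L) ∨ (∃ L e, e < L ∧ L ≤ s ∧ x = 2 ^ L + 2 ^ e) := by
  obtain ⟨a, b, ha, hb, rfl⟩ := hx
  rcases lt_trichotomy a b with h | rfl | h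
  · exact Or.inr ⟨b, a, h, hb, by ring⟩
  · exact Or.inl ⟨a + 1, by omega, by omega, by ring⟩
  · exact Or.inr ⟨a, b, h, ha, rfl⟩

/-- Level, decomposition and residue of a 2-bit number. -/
theorem lv_rs {s x : ℕ} (hx : IsTwoBit s x) :
    1 ≤ lv x ∧ lv x ≤ s + 1 ∧ x = 2 ^ lv x + rs x ∧
      (rs x = 0 ∨ ∃ e, e < lv x ∧ e + 1 ≤ s ∧ rs x = 2 ^ e) := by
  rcases twoBit_cases hx with ⟨L, h1, h2, rfl⟩ | ⟨L, e, h1, h2, rfl⟩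
  · have hl : lv (2 ^ L) = L := lv_pow L
    have hr : rs (2 ^ L) = 0 := by unfold rs; rw [hl]; exact Nat.sub_self _
    refine ⟨by omega, by omega, ?_, Or.inl hr⟩
    rw [hr, hl]; rfl
  · have hl : lv (2 ^ L + 2 ^ e) = L := lv_pow_add h1
    have hr : rs (2 ^ L + 2 ^ e) = 2 ^ e := by unfold rs; rw [hl]; exact Nat.add_sub_cancel_left ..
    refine ⟨by omega, by omega, ?_, Or.inr ⟨e, by omega, by omega, hr⟩⟩
    rw [hr, hl]

/-- log of the residue is at most `s`. -/
theorem log_rs_le {s x : ℕ} (hx : IsTwoBit s x) : Nat.log 2 (rs x) ≤ s := by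
  obtain ⟨-, -, -, h | ⟨e, -, he, h⟩⟩ := lv_rs hx
  · rw [h]; simp
  · rw [h, Nat.log_pow (by norm_num)]; omega

/-- GAP LEMMA.  Two 2-bit numbers `x < x'` on the same level: the gap is comparable to the larger residue
(`rs x' ≤ 2 (x' − x)`, `x' − x ≤ rs x'`) and that residue is a single power `2^e`, `e + 1 ≤ s`. -/
theorem gap {s x x' : ℕ} (hx : IsTwoBit s x) (hx' : IsTwoBit s x') (hlt : x < x') (hlv : lv x = lv x') :
    rs x' ≤ 2 * (x' - x) ∧ x' - x ≤ rs x' ∧ ∃ e, e + 1 ≤ s ∧ rs x' = 2 ^ e := by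
  obtain ⟨-, -, hxe, hxr⟩ := lv_rs hx
  obtain ⟨-, -, hxe', hxr'⟩ := lv_rs hx'
  rw [hlv] at hxe hxr
  have hrr : rs x < rs x' := by omega
  have hx'pos : rs x' ≠ 0 := by omega
  rcases hxr' with h0 | ⟨e', -, he's, hr'⟩
  · exact absurd h0 hx'pos
  have h2r : 2 * rs x ≤ rs x' := by
    rcases hxr with h0 | ⟨e, -, -, hr⟩
    · rw [h0]; omega
    · rw [hr, hr']
      rw [hr, hr'] at hrr
      have hee : e < e' := (Nat.pow_lt_pow_iff_right (by norm_num)).1 hrr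
      calc 2 * 2 ^ e = 2 ^ (e + 1) := by ring
        _ ≤ 2 ^ e' := Nat.pow_le_pow_right (by norm_num) hee
  refine ⟨by omega, by omega, e', he's, hr'⟩

/-! ### 6.2  Geometry of LL-visible points -/

/-- LL-visible points of a set: strict `ξ`-tops for some weight in the open negative quadrant. -/
def Vis (S : Set Expo) : Set Expo :=
  {l | ∃ ξ : Fin 2 → ℝ, ξ 0 < 0 ∧ ξ 1 < 0 ∧ IsStrictTop ξ S l}

theorem vis_subset (S : Set Expo) : Vis S ⊆ S := fun _ ⟨_, _, _, hl, _⟩ => hl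

/-- Domination kills visibility: a point of `S` weakly south-west of a visible point IS that point. -/
theorem eq_of_le_of_vis {S : Set Expo} {p q : Expo} (hp : p ∈ Vis S) (hq : q ∈ S)
    (h0 : q 0 ≤ p 0) (h1 : q 1 ≤ p 1) : q = p := by
  obtain ⟨ξ, hξ0, hξ1, -, htop⟩ := hp
  by_contra hne
  have hlt := htop q hq hne
  unfold wt at hlt
  have h0' : ((q 0 : ℕ) : ℝ) ≤ ((p 0 : ℕ) : ℝ) := by exact_mod_cast h0
  have h1' : ((q 1 : ℕ) : ℝ) ≤ ((p 1 : ℕ) : ℝ) := by exact_mod_cast h1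
  nlinarith [mul_le_mul_of_nonpos_left h0' hξ0.le, mul_le_mul_of_nonpos_left h1' hξ1.le]

/-- Visible points with the same abscissa coincide. -/
theorem vis_eq_of_x_eq {S : Set Expo} {p q : Expo} (hp : p ∈ Vis S) (hq : q ∈ Vis S) (h : p 0 = q 0) :
    p = q := by
  rcases le_total (p 1) (q 1) with h1 | h1
  · exact eq_of_le_of_vis hq (vis_subset S hp) h.le h1
  · exact (eq_of_le_of_vis hp (vis_subset S hq) h.ge h1).symm

/-- Visible points with the same ordinate coincide. -/
theorem vis_eq_of_y_eq {S : Set Expo} {p q : Expo} (hp : p ∈ Vis S) (hq : q ∈ Vis S) (h : p 1 = q 1) :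
    p = q := by
  rcases le_total (p 0) (q 0) with h0 | h0
  · exact eq_of_le_of_vis hq (vis_subset S hp) h0 h.le
  · exact (eq_of_le_of_vis hp (vis_subset S hq) h0 h.ge).symm

/-- Distinct visible points have distinct abscissae. -/
theorem vis_x_ne {S : Set Expo} {p q : Expo} (hp : p ∈ Vis S) (hq : q ∈ Vis S) (hne : p ≠ q) : p 0 ≠ q 0 :=
  fun h => hne (vis_eq_of_x_eq hp hq h)

/-- Antichain: along the visible set the ordinate strictly decreases as the abscissa increases. -/
theorem vis_y_lt {S : Set Expo} {p q : Expo} (hp : p ∈ Vis S) (hq : q ∈ Vis S) (h : p 0 < q 0) :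
    q 1 < p 1 := by
  by_contra hle
  push Not at hle
  have := eq_of_le_of_vis hq (vis_subset S hp) h.le hle
  rw [this] at h
  exact lt_irrefl _ h

/-- CONVEXITY at a visible point `q` between `a` and `c` (abscissae `a₀ < q₀ < c₀`): the slope into `q` exceeds the
slope out of `q`, cross-multiplied over `ℝ`. -/
theorem convex3 {S : Set Expo} {a q c : Expo} (hq : q ∈ Vis S) (ha : a ∈ S) (hc : c ∈ S)
    (haq : a 0 < q 0) (hqc : q 0 < c 0) :
    (((q 1 : ℕ) : ℝ) - ((c 1 : ℕ) : ℝ)) * (((q 0 : ℕ) : ℝ) - ((a 0 : ℕ) : ℝ)) <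
      (((a 1 : ℕ) : ℝ) - ((q 1 : ℕ) : ℝ)) * (((c 0 : ℕ) : ℝ) - ((q 0 : ℕ) : ℝ)) := by
  obtain ⟨ξ, hξ0, hξ1, -, htop⟩ := hq
  have hane : a ≠ q := fun h => by rw [h] at haq; exact lt_irrefl _ haq
  have hcne : c ≠ q := fun h => by rw [h] at hqc; exact lt_irrefl _ hqc
  have h1 := htop a ha hane
  have h2 := htop c hc hcne
  unfold wt at h1 h2
  have haq' : ((a 0 : ℕ) : ℝ) < ((q 0 : ℕ) : ℝ) := by exact_mod_cast haq
  have hqc' : ((q 0 : ℕ) : ℝ) < ((c 0 : ℕ) : ℝ) := by exact_mod_cast hqc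
  have hB : (0 : ℝ) < ((q 0 : ℕ) : ℝ) - ((a 0 : ℕ) : ℝ) := by linarith
  have hC : (0 : ℝ) < ((c 0 : ℕ) : ℝ) - ((q 0 : ℕ) : ℝ) := by linarith
  have hμ : (0 : ℝ) < -ξ 1 := by linarith
  have e1 : (-ξ 0) * (((q 0 : ℕ) : ℝ) - ((a 0 : ℕ) : ℝ)) <
      (-ξ 1) * (((a 1 : ℕ) : ℝ) - ((q 1 : ℕ) : ℝ)) := by linarith
  have e2 : (-ξ 1) * (((q 1 : ℕ) : ℝ) - ((c 1 : ℕ) : ℝ)) <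
      (-ξ 0) * (((c 0 : ℕ) : ℝ) - ((q 0 : ℕ) : ℝ)) := by linarith
  have e3 := mul_lt_mul_of_pos_right e1 hC
  have e4 := mul_lt_mul_of_pos_right e2 hB
  have e5 : (-ξ 1) * ((((q 1 : ℕ) : ℝ) - ((c 1 : ℕ) : ℝ)) * (((q 0 : ℕ) : ℝ) - ((a 0 : ℕ) : ℝ))) <
      (-ξ 1) * ((((a 1 : ℕ) : ℝ) - ((q 1 : ℕ) : ℝ)) * (((c 0 : ℕ) : ℝ) - ((q 0 : ℕ) : ℝ))) := by
    linarith
  exact lt_of_mul_lt_mul_left e5 hμ.le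

/-- EDGE COMPARISON: for visible `w, x, y, z` with `w₀ < x₀ ≤ y₀ < z₀` the slope of the edge `(w,x)` exceeds the slope of
the edge `(y,z)` (cross-multiplied over `ℝ`). -/
theorem convex4 {S : Set Expo} {w x y z : Expo} (hw : w ∈ Vis S) (hx : x ∈ Vis S) (hy : y ∈ Vis S)
    (hz : z ∈ Vis S) (hwx : w 0 < x 0) (hxy : x 0 ≤ y 0) (hyz : y 0 < z 0) :
    (((y 1 : ℕ) : ℝ) - ((z 1 : ℕ) : ℝ)) * (((x 0 : ℕ) : ℝ) - ((w 0 : ℕ) : ℝ)) <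
      (((w 1 : ℕ) : ℝ) - ((x 1 : ℕ) : ℝ)) * (((z 0 : ℕ) : ℝ) - ((y 0 : ℕ) : ℝ)) := by
  rcases hxy.eq_or_lt with heq | hlt
  · have hxy' : x = y := vis_eq_of_x_eq hx hy heq
    subst hxy'
    exact convex3 hx (vis_subset S hw) (vis_subset S hz) hwx hyz
  · have c1 := convex3 hx (vis_subset S hw) (vis_subset S hy) hwx hlt
    have c2 := convex3 hy (vis_subset S hx) (vis_subset S hz) hlt hyz
    have hB : (0 : ℝ) < ((x 0 : ℕ) : ℝ) - ((w 0 : ℕ) : ℝ) := by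
      have : ((w 0 : ℕ) : ℝ) < ((x 0 : ℕ) : ℝ) := by exact_mod_cast hwx
      linarith
    have hE : (0 : ℝ) < ((y 0 : ℕ) : ℝ) - ((x 0 : ℕ) : ℝ) := by
      have : ((x 0 : ℕ) : ℝ) < ((y 0 : ℕ) : ℝ) := by exact_mod_cast hlt
      linarith
    have hG : (0 : ℝ) < ((z 0 : ℕ) : ℝ) - ((y 0 : ℕ) : ℝ) := by
      have : ((y 0 : ℕ) : ℝ) < ((z 0 : ℕ) : ℝ) := by exact_mod_cast hyz
      linarith
    have e3 := mul_lt_mul_of_pos_right c2 hB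
    have e4 := mul_lt_mul_of_pos_right c1 hG
    have e5 : (((y 0 : ℕ) : ℝ) - ((x 0 : ℕ) : ℝ)) *
        ((((y 1 : ℕ) : ℝ) - ((z 1 : ℕ) : ℝ)) * (((x 0 : ℕ) : ℝ) - ((w 0 : ℕ) : ℝ))) <
        (((y 0 : ℕ) : ℝ) - ((x 0 : ℕ) : ℝ)) *
        ((((w 1 : ℕ) : ℝ) - ((x 1 : ℕ) : ℝ)) * (((z 0 : ℕ) : ℝ) - ((y 0 : ℕ) : ℝ))) := by
      nlinarith
    exact lt_of_mul_lt_mul_left e5 hE.le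

/-- The edge comparison in natural-number currency (all four differences are positive). -/
theorem convex4_nat {S : Set Expo} {w x y z : Expo} (hw : w ∈ Vis S) (hx : x ∈ Vis S) (hy : y ∈ Vis S)
    (hz : z ∈ Vis S) (hwx : w 0 < x 0) (hxy : x 0 ≤ y 0) (hyz : y 0 < z 0) :
    (y 1 - z 1) * (x 0 - w 0) < (w 1 - x 1) * (z 0 - y 0) := by
  have h := convex4 hw hx hy hz hwx hxy hyz
  have h1 : x 1 < w 1 := vis_y_lt hw hx hwx
  have h2 : z 1 < y 1 := vis_y_lt hy hz hyz
  have e1 : (((y 1 - z 1 : ℕ) : ℕ) : ℝ) = ((y 1 : ℕ) : ℝ) - ((z 1 : ℕ) : ℝ) := by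
    rw [Nat.cast_sub h2.le]
  have e2 : (((x 0 - w 0 : ℕ) : ℕ) : ℝ) = ((x 0 : ℕ) : ℝ) - ((w 0 : ℕ) : ℝ) := by
    rw [Nat.cast_sub hwx.le]
  have e3 : (((w 1 - x 1 : ℕ) : ℕ) : ℝ) = ((w 1 : ℕ) : ℝ) - ((x 1 : ℕ) : ℝ) := by
    rw [Nat.cast_sub h1.le]
  have e4 : (((z 0 - y 0 : ℕ) : ℕ) : ℝ) = ((z 0 : ℕ) : ℝ) - ((y 0 : ℕ) : ℝ) := by
    rw [Nat.cast_sub hyz.le]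
  rw [← e1, ← e2, ← e3, ← e4] at h
  exact_mod_cast h

/-! ### 6.3  Blocks, the block-first points and the monotone label `T` -/

/-- Same binary block. -/
def SameBlock (p q : Expo) : Prop := lv (p 0) = lv (q 0) ∧ lv (p 1) = lv (q 1)

/-- Non-first points of their block (they have an in-block visible point to their left). -/
def Rest (S : Set Expo) : Set Expo :=
  {q | q ∈ Vis S ∧ ∃ p ∈ Vis S, p 0 < q 0 ∧ SameBlock p q}

/-- Block-first points. -/
def First (S : Set Expo) : Set Expo :=
  {q | q ∈ Vis S ∧ ¬ ∃ p ∈ Vis S, p 0 < q 0 ∧ SameBlock p q}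

theorem vis_eq_first_union_rest (S : Set Expo) : Vis S = First S ∪ Rest S := by
  ext q
  constructor
  · intro hq
    by_cases h : ∃ p ∈ Vis S, p 0 < q 0 ∧ SameBlock p q
    · exact Or.inr ⟨hq, h⟩
    · exact Or.inl ⟨hq, h⟩
  · rintro (⟨hq, -⟩ | ⟨hq, -⟩) <;> exact hq

/-- The monotone block label. -/
def T (s : ℕ) (q : Expo) : ℕ := lv (q 0) + (s + 2 - lv (q 1))

section Main

variable {S : Set Expo} {s : ℕ} (hS : S ⊆ LevelTwoSet s)
include hS

theorem twoBit_x {q : Expo} (hq : q ∈ S) : IsTwoBit s (q 0) := by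
  obtain ⟨a, b, c, d, ha, hb, -, -, h0, -⟩ := hS hq
  exact ⟨a, b, ha, hb, h0⟩

theorem twoBit_y {q : Expo} (hq : q ∈ S) : IsTwoBit s (q 1) := by
  obtain ⟨a, b, c, d, -, -, hc, hd, -, h1⟩ := hS hq
  exact ⟨c, d, hc, hd, h1⟩

/-- `T` is monotone along the visible set … -/
theorem T_mono {p q : Expo} (hp : p ∈ Vis S) (hq : q ∈ Vis S) (h : p 0 < q 0) : T s p ≤ T s q := by
  have hx : lv (p 0) ≤ lv (q 0) := Nat.log_mono_right h.le
  have hy : lv (q 1) ≤ lv (p 1) := Nat.log_mono_right (vis_y_lt hp hq h).le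
  have hp1 := (lv_rs (twoBit_y hS (vis_subset S hp))).2.1
  unfold T
  omega

/-- … and strictly monotone across blocks. -/
theorem T_strict {p q : Expo} (hp : p ∈ Vis S) (hq : q ∈ Vis S) (h : p 0 < q 0) (hb : ¬ SameBlock p q) :
    T s p < T s q := by
  have hx : lv (p 0) ≤ lv (q 0) := Nat.log_mono_right h.le
  have hy : lv (q 1) ≤ lv (p 1) := Nat.log_mono_right (vis_y_lt hp hq h).le
  have hp1 := (lv_rs (twoBit_y hS (vis_subset S hp))).2.1
  have hq1 := (lv_rs (twoBit_y hS (vis_subset S hq))).2.1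
  unfold SameBlock at hb
  unfold T
  omega

theorem T_range {q : Expo} (hq : q ∈ Vis S) : T s q ∈ (Finset.Icc 1 (2 * s + 2) : Finset ℕ) := by
  have h0 := lv_rs (twoBit_x hS (vis_subset S hq))
  have h1 := lv_rs (twoBit_y hS (vis_subset S hq))
  rw [Finset.mem_Icc]
  unfold T
  omega

theorem first_injOn : Set.InjOn (T s) (First S) := by
  intro p hp q hq hT
  obtain ⟨hpV, hpn⟩ := hp
  obtain ⟨hqV, hqn⟩ := hq
  by_contra hne
  rcases lt_or_gt_of_ne (vis_x_ne hpV hqV hne) with h | h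
  · by_cases hb : SameBlock p q
    · exact hqn ⟨p, hpV, h, hb⟩
    · exact absurd hT (T_strict hS hpV hqV h hb).ne
  · by_cases hb : SameBlock q p
    · exact hpn ⟨q, hqV, h, hb⟩
    · exact absurd hT.symm (T_strict hS hqV hpV h hb).ne

theorem ncard_first_le : (First S).ncard ≤ 2 * (s + 1) := by
  have h := Set.ncard_le_ncard_of_injOn (T s) (fun q hq => (T_range hS hq.1 : T s q ∈
      (↑(Finset.Icc 1 (2 * s + 2) : Finset ℕ) : Set ℕ))) (first_injOn hS)
  rw [Set.ncard_coe_finset, Nat.card_Icc] at h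
  omega

/-! ### 6.4  The in-block predecessor and the slope proxy `n`, the label `Φ` -/

/-- ordinate of the visible predecessor (the visible point with the next smaller abscissa has the smallest ordinate
among the visible points to the left). -/
def predY (S : Set Expo) (q : Expo) : ℕ := sInf {y | ∃ p ∈ Vis S, p 0 < q 0 ∧ p 1 = y}

/-- slope proxy of the incoming edge: `log₂ (x-residue of q) − log₂ (y-residue of the predecessor)`. -/
def nfun (S : Set Expo) (q : Expo) : ℤ :=
  (Nat.log 2 (rs (q 0)) : ℤ) - (Nat.log 2 (predY S q - 2 ^ lv (q 1)) : ℤ)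

/-- the strictly increasing label. -/
def Φ (S : Set Expo) (s : ℕ) (q : Expo) : ℤ := nfun S q + 2 * (T s q : ℤ)

omit hS in
/-- The predecessor of a non-first point: exists, is extremal, and lies in the same block. -/
theorem pred_spec {q : Expo} (hq : q ∈ Rest S) :
    ∃ p ∈ Vis S, p 0 < q 0 ∧ p 1 = predY S q ∧ (∀ r ∈ Vis S, r 0 < q 0 → predY S q ≤ r 1) ∧
      (∀ r ∈ Vis S, r 0 < q 0 → r 0 ≤ p 0) ∧ SameBlock p q := by
  obtain ⟨hqV, p₀, hp₀V, hp₀x, hp₀b⟩ := hq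
  set Y := predY S q with hY
  have hne : ({y | ∃ p ∈ Vis S, p 0 < q 0 ∧ p 1 = y} : Set ℕ).Nonempty := ⟨p₀ 1, p₀, hp₀V, hp₀x, rfl⟩
  have hmem : Y ∈ {y | ∃ p ∈ Vis S, p 0 < q 0 ∧ p 1 = y} := by
    rw [hY]; unfold predY; exact Nat.sInf_mem hne
  obtain ⟨p, hpV, hpx, hpy⟩ := hmem
  have hmin : ∀ r ∈ Vis S, r 0 < q 0 → Y ≤ r 1 := by
    intro r hr hrx
    rw [hY]; unfold predY
    exact Nat.sInf_le ⟨r, hr, hrx, rfl⟩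
  have hmax : ∀ r ∈ Vis S, r 0 < q 0 → r 0 ≤ p 0 := by
    intro r hr hrx
    by_contra hlt
    push Not at hlt
    have h1 : r 1 < p 1 := vis_y_lt hpV hr hlt
    have h2 := hmin r hr hrx
    omega
  refine ⟨p, hpV, hpx, hpy, hmin, hmax, ?_⟩
  -- same block: squeeze between p₀ and q
  have h₀p : p₀ 0 ≤ p 0 := hmax p₀ hp₀V hp₀x
  have hx1 : lv (p₀ 0) ≤ lv (p 0) := Nat.log_mono_right h₀p
  have hx2 : lv (p 0) ≤ lv (q 0) := Nat.log_mono_right hpx.le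
  have hy1 : lv (q 1) ≤ lv (p 1) := Nat.log_mono_right (vis_y_lt hpV hqV hpx).le
  have hp₀y : p 1 ≤ p₀ 1 := by rw [hpy]; exact hmin p₀ hp₀V hp₀x
  have hy2 : lv (p 1) ≤ lv (p₀ 1) := Nat.log_mono_right hp₀y
  obtain ⟨hbx, hby⟩ := hp₀b
  exact ⟨by omega, by omega⟩

/-- KEY ESTIMATE (ii): along the visible set the proxy drops by at most one … -/
theorem nfun_step {q q' : Expo} (hq : q ∈ Rest S) (hq' : q' ∈ Rest S) (h : q 0 < q' 0) :
    nfun S q - 1 ≤ nfun S q' ∧ (SameBlock q q' → nfun S q + 2 ≤ nfun S q') := by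
  obtain ⟨p, hpV, hpx, hpy, hmin, hmax, hpb⟩ := pred_spec hq
  obtain ⟨p', hp'V, hp'x, hp'y, hmin', hmax', hp'b⟩ := pred_spec hq'
  have hqV : q ∈ Vis S := hq.1
  have hq'V : q' ∈ Vis S := hq'.1
  -- Claim A: q₀ ≤ p'₀
  have hA : q 0 ≤ p' 0 := by
    by_contra hlt
    push Not at hlt
    have h1 : q 1 < p' 1 := vis_y_lt hp'V hqV hlt
    have h2 : predY S q' ≤ q 1 := hmin' q hqV h
    omega
  -- the edge comparison Δy'·Δx < Δy·Δx'
  have hedge := convex4_nat hpV hqV hp'V hq'V hpx hA hp'x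
  -- 2-bit data
  have hpq1 : q 1 < p 1 := vis_y_lt hpV hqV hpx
  have hpq1' : q' 1 < p' 1 := vis_y_lt hp'V hq'V hp'x
  have tq0 := twoBit_x hS (vis_subset S hqV)
  have tp0 := twoBit_x hS (vis_subset S hpV)
  have tq1 := twoBit_y hS (vis_subset S hqV)
  have tp1 := twoBit_y hS (vis_subset S hpV)
  have tq0' := twoBit_x hS (vis_subset S hq'V)
  have tp0' := twoBit_x hS (vis_subset S hp'V)
  have tq1' := twoBit_y hS (vis_subset S hq'V)
  have tp1' := twoBit_y hS (vis_subset S hp'V)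
  -- gap lemmas on the four edges' coordinates
  obtain ⟨gx1, gx2, a, ha, hra⟩ := gap tp0 tq0 hpx hpb.1
  obtain ⟨gy1, gy2, d, hd, hrd⟩ := gap tq1 tp1 hpq1 hpb.2.symm
  obtain ⟨gx1', gx2', a', ha', hra'⟩ := gap tp0' tq0' hp'x hp'b.1
  obtain ⟨gy1', gy2', d', hd', hrd'⟩ := gap tq1' tp1' hpq1' hp'b.2.symm
  -- identify the proxy values
  have hn : nfun S q = (a : ℤ) - (d : ℤ) := by
    unfold nfun
    rw [hra, Nat.log_pow (by norm_num), ← hpy, ← hpb.2]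
    change (a : ℤ) - (Nat.log 2 (rs (p 1)) : ℤ) = _
    rw [hrd, Nat.log_pow (by norm_num)]
  have hn' : nfun S q' = (a' : ℤ) - (d' : ℤ) := by
    unfold nfun
    rw [hra', Nat.log_pow (by norm_num), ← hp'y, ← hp'b.2]
    change (a' : ℤ) - (Nat.log 2 (rs (p' 1)) : ℤ) = _
    rw [hrd', Nat.log_pow (by norm_num)]
  -- the power inequality 2^(d'+a) < 2^(d+a'+2)
  have hpow : 2 ^ (d' + a) < 2 ^ (d + a' + 2) := by
    have e1 : 2 ^ d' * 2 ^ a ≤ 4 * ((p' 1 - q' 1) * (q 0 - p 0)) := by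
      rw [← hrd', ← hra]
      calc rs (p' 1) * rs (q 0) ≤ (2 * (p' 1 - q' 1)) * (2 * (q 0 - p 0)) := Nat.mul_le_mul gy1' gx1
        _ = 4 * ((p' 1 - q' 1) * (q 0 - p 0)) := by ring
    have e2 : (p 1 - q 1) * (q' 0 - p' 0) ≤ 2 ^ d * 2 ^ a' := by
      rw [← hrd, ← hra']
      exact Nat.mul_le_mul gy2 gx2'
    calc 2 ^ (d' + a) = 2 ^ d' * 2 ^ a := by rw [pow_add]
      _ ≤ 4 * ((p' 1 - q' 1) * (q 0 - p 0)) := e1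
      _ < 4 * ((p 1 - q 1) * (q' 0 - p' 0)) := by
          have := hedge; omega
      _ ≤ 4 * (2 ^ d * 2 ^ a') := Nat.mul_le_mul_left 4 e2
      _ = 2 ^ (d + a' + 2) := by rw [pow_add, pow_add]; ring
  have hexp : d' + a < d + a' + 2 := (Nat.pow_lt_pow_iff_right (by norm_num)).1 hpow
  refine ⟨by rw [hn, hn']; omega, fun hsame => ?_⟩
  -- same block: a < a' and d' < d
  have hL : lv (q 0) = lv (q' 0) := hsame.1
  have hM : lv (p 1) = lv (p' 1) := by rw [hpb.2, hsame.2, ← hp'b.2]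
  have haa : a < a' := by
    have h1 : rs (q 0) < rs (q' 0) := by
      have e0 := (lv_rs tq0).2.2.1
      have e0' := (lv_rs tq0').2.2.1
      rw [hL] at e0
      omega
    rw [hra, hra'] at h1
    exact (Nat.pow_lt_pow_iff_right (by norm_num)).1 h1
  have hdd : d' < d := by
    have h3 : p' 1 ≤ q 1 := by rw [hp'y]; exact hmin' q hqV h
    have h1 : rs (p' 1) < rs (p 1) := by
      have e0 := (lv_rs tp1).2.2.1
      have e0' := (lv_rs tp1').2.2.1
      rw [← hM] at e0'
      omega
    rw [hrd, hrd'] at h1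
    exact (Nat.pow_lt_pow_iff_right (by norm_num)).1 h1
  rw [hn, hn']
  omega

/-- `Φ` is strictly increasing along the non-first visible points. -/
theorem Φ_strict {q q' : Expo} (hq : q ∈ Rest S) (hq' : q' ∈ Rest S) (h : q 0 < q' 0) :
    Φ S s q < Φ S s q' := by
  obtain ⟨h1, h2⟩ := nfun_step hS hq hq' h
  unfold Φ
  by_cases hb : SameBlock q q'
  · have hT : T s q = T s q' := by
      unfold T; rw [hb.1, hb.2]
    have := h2 hb
    rw [hT]
    omega
  · have hT : T s q < T s q' := T_strict hS hq.1 hq'.1 h hb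
    have hT' : (T s q : ℤ) + 1 ≤ (T s q' : ℤ) := by exact_mod_cast hT
    omega

theorem rest_injOn : Set.InjOn (Φ S s) (Rest S) := by
  intro p hp q hq hΦ
  by_contra hne
  rcases lt_or_gt_of_ne (vis_x_ne hp.1 hq.1 hne) with h | h
  · exact absurd hΦ (Φ_strict hS hp hq h).ne
  · exact absurd hΦ.symm (Φ_strict hS hq hp h).ne

theorem Φ_range {q : Expo} (hq : q ∈ Rest S) :
    Φ S s q ∈ (Finset.Icc (-(s : ℤ)) (5 * s + 5) : Finset ℤ) := by
  obtain ⟨p, hpV, hpx, hpy, -, -, hpb⟩ := pred_spec hq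
  have hqV := hq.1
  have hT := T_range hS hqV
  rw [Finset.mem_Icc] at hT ⊢
  have ha : Nat.log 2 (rs (q 0)) ≤ s := log_rs_le (twoBit_x hS (vis_subset S hqV))
  have hd : Nat.log 2 (predY S q - 2 ^ lv (q 1)) ≤ s := by
    rw [← hpy, ← hpb.2]
    exact log_rs_le (twoBit_y hS (vis_subset S hpV))
  unfold Φ nfun
  constructor <;> omega

theorem ncard_rest_le : (Rest S).ncard ≤ 6 * (s + 1) := by
  have h := Set.ncard_le_ncard_of_injOn (Φ S s) (fun q hq => (Φ_range hS hq : Φ S s q ∈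
      (↑(Finset.Icc (-(s : ℤ)) (5 * s + 5) : Finset ℤ) : Set ℤ))) (rest_injOn hS)
  rw [Set.ncard_coe_finset, Int.card_Icc] at h
  have e : (5 * (s : ℤ) + 5 + 1 - -(s : ℤ)) = ((6 * (s + 1) : ℕ) : ℤ) := by push_cast; ring
  rw [e, Int.toNat_natCast] at h
  exact h

/-- THE CEILING for a level-2 support. -/
theorem ncard_vis_le : (Vis S).ncard ≤ 8 * (s + 1) := by
  rw [vis_eq_first_union_rest S]
  calc (First S ∪ Rest S).ncard ≤ (First S).ncard + (Rest S).ncard := Set.ncard_union_le _ _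
    _ ≤ 2 * (s + 1) + 6 * (s + 1) := Nat.add_le_add (ncard_first_le hS) (ncard_rest_le hS)
    _ = 8 * (s + 1) := by ring

end Main

end TwoBit

/-- **THE 2-BIT CHAIN CEILING (kernel, C = 8).**  Every polynomial supported on the level-2 set `LevelTwoSet s` has at
most `8(s+1)` LL-visible points.  Closes the typed conjecture `TwoBitChainCeiling` of rev 3 (exact data `4s − 5`,
s ≤ 11). -/
theorem twoBitChainCeiling_holds : TwoBitChainCeiling := by
  refine ⟨8, fun s P hP => ?_⟩
  have h : llVisibleOf P = TwoBit.Vis (↑P.support : Set Expo) := rfl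
  rw [h]
  exact TwoBit.ncard_vis_le hP

/-! ### 6.6  The SECOND RUNG: §5 (k = 2) + §6 for the first variation on the digit grid

The level-2 ladder set `lowSums W 2 ∪ {i•d : d ∈ W, i ≤ 3}` over letters `W ⊆ A_s` sits inside `LevelTwoSet s` except for the
origin and the letters with a unit coordinate (`2^0`); LL-visible points among those are ≤ 3 (one origin, one per line `x = 1`,
`y = 1` by the antichain property).  Hence the count `≤ 8(s+1) + 3` whenever every LL direction has a maximal letter with a live
pure multiple of order ≤ 3 — the rank-one-datum ladder's second rung (first rung `firstRung`: order 2 live ⇒ `≤ s+1`). -/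

/-- Points of the level-2 ladder set off `LevelTwoSet s`: the origin or a unit coordinate. -/
theorem levelTwo_or_small (s : ℕ) (W : Finset Expo) (hW : ∀ e ∈ W, e ∈ DigitGrid s) (n : Expo)
    (hn : n ∈ lowSums W 2 ∪ {n | ∃ d ∈ W, ∃ i : ℕ, 1 ≤ i ∧ i ≤ 2 + 1 ∧ n = i • d}) :
    n ∈ LevelTwoSet s ∨ n = 0 ∨ n 0 = 1 ∨ n 1 = 1 := by
  have hletter : ∀ d ∈ W, d ∈ LevelTwoSet s ∨ d 0 = 1 ∨ d 1 = 1 := by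
    intro d hd
    obtain ⟨a, b, ha, hb, h0, h1⟩ := hW d hd
    rcases Nat.eq_zero_or_pos a with rfl | hapos
    · exact Or.inr (Or.inl (by rw [h0, pow_zero]))
    rcases Nat.eq_zero_or_pos b with rfl | hbpos
    · exact Or.inr (Or.inr (by rw [h1, pow_zero]))
    obtain ⟨a', rfl⟩ : ∃ a', a = a' + 1 := ⟨a - 1, by omega⟩
    obtain ⟨b', rfl⟩ : ∃ b', b = b' + 1 := ⟨b - 1, by omega⟩
    refine Or.inl ⟨a', a', b', b', by omega, by omega, by omega, by omega, ?_, ?_⟩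
    · rw [h0, pow_succ]; ring
    · rw [h1, pow_succ]; ring
  rcases hn with ⟨M, hMW, hcard, hsum⟩ | ⟨d, hd, i, hi1, hi3, rfl⟩
  · have hc : Multiset.card M = 0 ∨ Multiset.card M = 1 ∨ Multiset.card M = 2 := by omega
    rcases hc with hc | hc | hc
    · have hM : M = 0 := Multiset.card_eq_zero.1 hc
      subst hM
      rw [Multiset.sum_zero] at hsum
      exact Or.inr (Or.inl hsum.symm)
    · obtain ⟨x, rfl⟩ := Multiset.card_eq_one.1 hc
      rw [Multiset.sum_singleton] at hsum
      subst hsum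
      rcases hletter x (hMW x (Multiset.mem_singleton_self x)) with h | h | h
      · exact Or.inl h
      · exact Or.inr (Or.inr (Or.inl h))
      · exact Or.inr (Or.inr (Or.inr h))
    · obtain ⟨x, y, rfl⟩ := Multiset.card_eq_two.1 hc
      rw [Multiset.sum_pair] at hsum
      subst hsum
      obtain ⟨a, b, ha, hb, hx0, hx1⟩ := hW x (hMW x (Multiset.mem_cons_self x _))
      obtain ⟨a', b', ha', hb', hy0, hy1⟩ :=
        hW y (hMW y (Multiset.mem_cons_of_mem (Multiset.mem_singleton_self y)))
      refine Or.inl ⟨a, a', b, b', by omega, by omega, by omega, by omega, ?_, ?_⟩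
      · rw [Finsupp.add_apply, hx0, hy0]
      · rw [Finsupp.add_apply, hx1, hy1]
  · obtain ⟨a, b, ha, hb, h0, h1⟩ := hW d hd
    have hi : i = 1 ∨ i = 2 ∨ i = 3 := by omega
    rcases hi with rfl | rfl | rfl
    · rw [one_smul]
      rcases hletter d hd with h | h | h
      · exact Or.inl h
      · exact Or.inr (Or.inr (Or.inl h))
      · exact Or.inr (Or.inr (Or.inr h))
    · refine Or.inl ⟨a, a, b, b, by omega, by omega, by omega, by omega, ?_, ?_⟩
      · rw [Finsupp.smul_apply, smul_eq_mul, h0]; ring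
      · rw [Finsupp.smul_apply, smul_eq_mul, h1]; ring
    · refine Or.inl ⟨a, a + 1, b, b + 1, by omega, by omega, by omega, by omega, ?_, ?_⟩
      · rw [Finsupp.smul_apply, smul_eq_mul, h0]; ring
      · rw [Finsupp.smul_apply, smul_eq_mul, h1]; ring

/-- **SECOND RUNG.**  Rows on the digit grid `A_s`; if at every LL direction some maximal letter `d` has a live pure multiple
`i•d`, `1 ≤ i ≤ 3`, in `firstVariation u τ`, then `#llVisibleOf (firstVariation u τ) ≤ 8(s+1) + 3` (any `m`, any `τ`).  So a
count above `8s + 11` needs, for some LL direction, order-3 pure-power nulls `coeff d = coeff 2d = coeff 3d = 0` at EVERY maximal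
letter `d` (§5 reading, now with the ceiling proved). -/
theorem secondRung {m : ℕ} (s : ℕ) (u : Fin m → MvPolynomial (Fin 2) ℂ) (τ : Fin m → ℂ)
    (hu : ∀ j, ∀ e ∈ (u j).support, e ∈ DigitGrid s)
    (hlive : ∀ ξ : Fin 2 → ℝ, ξ 0 < 0 → ξ 1 < 0 → (∃ j, (u j).support.Nonempty) →
      ∃ j, ∃ d ∈ (u j).support, (∀ i, ∀ w ∈ (u i).support, wt ξ w ≤ wt ξ d) ∧
        ∃ i : ℕ, 1 ≤ i ∧ i ≤ 3 ∧ coeff (i • d) (firstVariation u τ) ≠ 0) :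
    (llVisibleOf (firstVariation u τ)).ncard ≤ 8 * (s + 1) + 3 := by
  classical
  set W : Finset Expo := Finset.univ.biUnion (fun j => (u j).support) with hWdef
  have hWgrid : ∀ e ∈ W, e ∈ DigitGrid s := by
    intro e he
    obtain ⟨j, -, hj⟩ := Finset.mem_biUnion.1 he
    exact hu j e hj
  have hsub := ladderContainment_firstVariation 2 u τ hlive
  set G := firstVariation u τ with hGdef
  set V : Set Expo := llVisibleOf G with hVdef
  have hVvis : V = TwoBit.Vis (↑G.support : Set Expo) := rfl
  have hVsupp : V ⊆ (↑G.support : Set Expo) := by rw [hVvis]; exact TwoBit.vis_subset _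
  have hVfin : V.Finite := G.support.finite_toSet.subset hVsupp
  -- the four pieces
  set A : Set Expo := V ∩ LevelTwoSet s with hAdef
  set E0 : Set Expo := {n | n ∈ V ∧ n = 0} with hE0def
  set E1 : Set Expo := {n | n ∈ V ∧ n 0 = 1} with hE1def
  set E2 : Set Expo := {n | n ∈ V ∧ n 1 = 1} with hE2def
  have hcover : V ⊆ ((A ∪ E0) ∪ E1) ∪ E2 := by
    intro n hn
    rcases levelTwo_or_small s W hWgrid n (hsub hn) with h | h | h | h
    · exact Or.inl (Or.inl (Or.inl ⟨hn, h⟩))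
    · exact Or.inl (Or.inl (Or.inr ⟨hn, h⟩))
    · exact Or.inl (Or.inr ⟨hn, h⟩)
    · exact Or.inr ⟨hn, h⟩
  have hA : A.ncard ≤ 8 * (s + 1) := by
    have hAself : A ⊆ TwoBit.Vis A := by
      rintro l ⟨hlV, hl2⟩
      have hlV' := hlV
      rw [hVvis] at hlV'
      obtain ⟨ξ, hξ0, hξ1, -, htop⟩ := hlV'
      exact ⟨ξ, hξ0, hξ1, ⟨hlV, hl2⟩, fun μ hμ hne => htop μ (hVsupp hμ.1) hne⟩
    have hfinVisA : (TwoBit.Vis A).Finite := hVfin.subset fun l hl => (TwoBit.vis_subset A hl).1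
    calc A.ncard ≤ (TwoBit.Vis A).ncard := Set.ncard_le_ncard hAself hfinVisA
      _ ≤ 8 * (s + 1) := TwoBit.ncard_vis_le (S := A) (fun l hl => hl.2)
  have hE0 : E0.ncard ≤ 1 := by
    rw [Set.ncard_le_one (hVfin.subset fun n hn => hn.1)]
    rintro a ⟨-, ha⟩ b ⟨-, hb⟩
    rw [ha, hb]
  have hE1 : E1.ncard ≤ 1 := by
    rw [Set.ncard_le_one (hVfin.subset fun n hn => hn.1)]
    rintro a ⟨ha, ha0⟩ b ⟨hb, hb0⟩
    rw [hVvis] at ha hb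
    exact TwoBit.vis_eq_of_x_eq ha hb (by rw [ha0, hb0])
  have hE2 : E2.ncard ≤ 1 := by
    rw [Set.ncard_le_one (hVfin.subset fun n hn => hn.1)]
    rintro a ⟨ha, ha1⟩ b ⟨hb, hb1⟩
    rw [hVvis] at ha hb
    exact TwoBit.vis_eq_of_y_eq ha hb (by rw [ha1, hb1])
  have hUfin : (((A ∪ E0) ∪ E1) ∪ E2).Finite :=
    (((hVfin.subset fun n hn => hn.1).union (hVfin.subset fun n hn => hn.1)).union
      (hVfin.subset fun n hn => hn.1)).union (hVfin.subset fun n hn => hn.1)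
  calc V.ncard ≤ (((A ∪ E0) ∪ E1) ∪ E2).ncard := Set.ncard_le_ncard hcover hUfin
    _ ≤ ((A ∪ E0) ∪ E1).ncard + E2.ncard := Set.ncard_union_le _ _
    _ ≤ (A ∪ E0).ncard + E1.ncard + E2.ncard := by
        have := Set.ncard_union_le (A ∪ E0) E1; omega
    _ ≤ A.ncard + E0.ncard + E1.ncard + E2.ncard := by
        have := Set.ncard_union_le A E0; omega
    _ ≤ 8 * (s + 1) + 3 := by omega

/-- NAMED HYPOTHESIS BINDER (rev 6, per val-idea-crit-8 g4 #48): the rows are supported on the digit grid `A_s = DigitGrid s`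
(`= {(2^a, 2^b) : a, b < s}`, the landed `…Negative.RowCoincidence.DigitGrid`). -/
def OnDigitGrid {m : ℕ} (s : ℕ) (u : Fin m → MvPolynomial (Fin 2) ℂ) : Prop :=
  ∀ j, ∀ e ∈ (u j).support, e ∈ DigitGrid s

/-- NAMED HYPOTHESIS BINDER (rev 6, per val-idea-crit-8 g4 #48) — «LIVE PURE MULTIPLE OF ORDER ≤ 3»: for every weight `ξ` in the open
negative quadrant (every LL direction), if some row is non-zero then some row `j` has a `ξ`-maximal letter `d` (maximal over ALL rows'
letters) one of whose pure multiples `d, 2•d, 3•d` has a non-zero coefficient in `firstVariation u τ`.  This is exactly the binder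
`hlive` of `secondRung` / `ladderContainment_firstVariation 2`; its failure for some `ξ` is the order-3 pure-power null
`coeff d = coeff (2•d) = coeff (3•d) = 0` at EVERY `ξ`-maximal letter. -/
def LiveOrderThree {m : ℕ} (u : Fin m → MvPolynomial (Fin 2) ℂ) (τ : Fin m → ℂ) : Prop :=
  ∀ ξ : Fin 2 → ℝ, ξ 0 < 0 → ξ 1 < 0 → (∃ j, (u j).support.Nonempty) →
    ∃ j, ∃ d ∈ (u j).support, (∀ i, ∀ w ∈ (u i).support, wt ξ w ≤ wt ξ d) ∧
      ∃ i : ℕ, 1 ≤ i ∧ i ≤ 3 ∧ coeff (i • d) (firstVariation u τ) ≠ 0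

/-- **SECOND RUNG, named-binder form** (same theorem as `secondRung`): `OnDigitGrid s u → LiveOrderThree u τ →
#llVisibleOf (firstVariation u τ) ≤ 8(s+1) + 3`. -/
theorem secondRung_named {m : ℕ} (s : ℕ) (u : Fin m → MvPolynomial (Fin 2) ℂ) (τ : Fin m → ℂ)
    (hu : OnDigitGrid s u) (hlive : LiveOrderThree u τ) :
    (llVisibleOf (firstVariation u τ)).ncard ≤ 8 * (s + 1) + 3 :=
  secondRung s u τ hu hlive

end Summit.ValiantsHypothesis.ValiantsHypothesis.Cruxes.TwoProducts.FirstVariation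

end
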